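import Literature.NumberTheory.Automorphic.SatakeParametersGLXiMinors
import Literature.NumberTheory.Automorphic.SatakeTransformGL
import Mathlib.Analysis.SpecialFunctions.Pow.Real
import HarnessLib

/-!
# The Harish-Chandra sum `Ξ` on `GL_n(𝒪) ϖ^λ GL_n(𝒪)`: the counting recursion

Topic `NumberTheory/Automorphic`; second file of the proof of the direction "unitary Satake
parameters ⇒ tempered" of the named fact
`Literature.NumberTheory.Automorphic.isTempered_iff_forall_norm_eq_one` (`SatakeParametersGL`).
Setting: a field `F` with a valuation whose valuation ring `𝒪` is a discrete valuation ring with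
finite residue field `𝓀` (`q = #𝓀`, `Q = √q`), a uniformizing element `ϖ`, `K = GL_n(𝒪)`,
`e(g) ∈ ℤⁿ` the Iwasawa exponent of `g = u ϖ^{e(g)} k` (`iwasawaExp`, `SatakeTransformGL`).

* `twoRho E = ∑_i (n - 1 - 2i) E_i = 2⟨ρ, E⟩` and the weight `xiWeight Q E = Q^{-2⟨ρ, E⟩}`, the
  value `δ_B(ϖ^E)^{1/2}` of the spherical vector of the trivially induced representation.
* `xiSum hϖ Q g = ∑_{c ∈ K·gK ⊆ G/K} Q^{-2⟨ρ, e(c)⟩}`: the Harish-Chandra function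
  `Ξ(g) = ∫_K δ_B^{1/2}(a(kg)) dk` times the degree `#(KgK/K)` (a `finsum`, `0` if the orbit were
  infinite); it only depends on the double coset `KgK`.
* `cornerExtGL y x d = [[y, x], [0, d]] ∈ GL_{n+1}(F)` and its Iwasawa exponent
  `e([[y, x], [0, ϖ^e]]) = (e(y), e)` (`iwasawaExp_cornerExtGL`), so that the weight factorises
  (`xiWeight_snoc`).
* **Row reduction** (`exists_coe_eq_cornerExtGL`): every integral `g ∈ GL_{n+1}(F)` has
  `g K = [[y, x], [0, ϖ^e]] K` with `y ∈ GL_n(F)` and `x` integral (clear the last row inside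
  `GL_{n+1}(𝒪)`, `exists_mul_glInt_isRowTriangularFrom` of `IwasawaDecompositionGL`).
* **The fibres** `xiFib hϖ λ y ⊆ G/K` of the cosets `[[y, x], [0, ϖ^e]] K` inside `K ϖ^λ K` with
  `x` integral: invariance under `y ↦ k₁ y k₂` (`xiFib_mul_glInt`, `ncard_xiFib_glInt_mul`) and
  **the fibre count** `#xiFib λ ϖ^{λ'} ≤ q^{∑_i (i+1) λ'_i - ∑_j j λ_j}`
  (`ncard_xiFib_piPowGL_le`): modulo `ϖ^{λ'} 𝒪ⁿ` the column `x` is determined by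
  `q^{∑ (λ'_t ∸ b_t)}` digits, where the divisibility `ϖ^{b_t} ∣ x_t`,
  `b_t = ∑_{j>t} λ_j - ∑_{i>t} λ'_i`, is read off the bordered minors of `[[ϖ^{λ'}, x], [0, ϖ^e]]`
  (`SatakeParametersGLXiMinors`).
* **The recursion** (`xiSum_piPowGL_succ_le`): for `λ ∈ ℕ^{n+1}` antitone,
  `Ξ-sum_{n+1}(ϖ^λ) ≤ ∑_{λ' antitone, |λ'| ≤ |λ|} Q^{2B(λ,λ') + n|λ| - (n+1)|λ'|} Ξ-sum_n(ϖ^{λ'})`,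
  by union bounds over the fibres, and since the exponents telescope exactly
  (`twoRho_recursion_identity`), **the Harish-Chandra estimate**
  `Ξ-sum_n(ϖ^λ) ≤ (|λ| + 1)^{n²} Q^{2⟨ρ, λ⟩}` (`xiSum_piPowGL_le`), i.e.
  `Ξ(ϖ^λ) #(Kϖ^λK/K) ≤ (|λ|+1)^{n²} q^{⟨ρ,λ⟩}` — the upper half of Harish-Chandra's
  `δ^{1/2}(a) ≤ Ξ(a) ≤ C δ^{1/2}(a) (1 + σ(a))^d` for `GL_n` (Macdonald (1971), Cartier (1979)
  §IV; Silberger (1979), §4.2; Waldspurger (2003), Lemme II.1.1), here with an elementary proof: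
  the branching of the lattice count from `GL_{n+1}` to `GL_n` in inequality form.

## References

* I. G. Macdonald, *Spherical functions on a group of 𝔭-adic type*, Ramanujan Institute (1971);
  *Symmetric functions and Hall polynomials*, 2nd ed. (1995), Ch. V §§2–3 [Macdonald1995].
* P. Cartier, *Representations of 𝔭-adic groups: a survey*, Proc. Sympos. Pure Math. 33 (1979),
  part 1, §IV [CartierCorvallis1979].
* J.-L. Waldspurger, *La formule de Plancherel pour les groupes 𝔭-adiques (d'après
  Harish-Chandra)*, J. Inst. Math. Jussieu 2 (2003), Lemme II.1.1.
-/

noncomputable section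

open scoped MatrixGroups Pointwise
open ValuativeRel Matrix Finset MulAction Literature.NumberTheory.Automorphic.Echelon

namespace Literature.NumberTheory.Automorphic

/-! ### The weight `Q^{-2⟨ρ, E⟩}` -/

section Weight

variable {n : ℕ}

/-- `2⟨ρ, E⟩ = ∑_i (n - 1 - 2 i) E_i` (`0`-indexed `i`; `ρ` the half sum of the positive roots of
`GL_n`, `2ρ = (n-1, n-3, …, 1-n)`). [folklore] -/
def twoRho (E : Fin n → ℤ) : ℤ := ∑ i : Fin n, ((n : ℤ) - 1 - 2 * (i : ℕ)) * E i

/-- Additivity of `2⟨ρ, ·⟩`. [folklore] -/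
theorem twoRho_add (a b : Fin n → ℤ) : twoRho (a + b) = twoRho a + twoRho b := by
  simp only [twoRho, Pi.add_apply, mul_add, Finset.sum_add_distrib]

/-- `2⟨ρ, 0⟩ = 0`. [folklore] -/
@[simp]
theorem twoRho_zero : twoRho (0 : Fin n → ℤ) = 0 := by
  simp [twoRho]

/-- `∑_{i < n} (n - 1 - 2 i) = 0`. [folklore] -/
theorem sum_sub_one_sub_two_mul_eq_zero (n : ℕ) :
    ∑ i : Fin n, ((n : ℤ) - 1 - 2 * (i : ℕ)) = 0 := by
  induction n with
  | zero => simp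
  | succ n ih =>
    rw [Fin.sum_univ_castSucc]
    have h : ∀ i : Fin n, (((n + 1 : ℕ) : ℤ) - 1 - 2 * ((i.castSucc : Fin (n + 1)) : ℕ)) =
        ((n : ℤ) - 1 - 2 * (i : ℕ)) + 1 := fun i => by
      rw [Fin.val_castSucc]
      push_cast
      ring
    rw [Finset.sum_congr rfl fun i _ => h i, Finset.sum_add_distrib, ih, Finset.sum_const,
      Finset.card_univ, Fintype.card_fin, Fin.val_last]
    push_cast
    ring

/-- `2⟨ρ, c·𝟙⟩ = 0`: the weight is invariant under the centre. [folklore] -/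
theorem twoRho_const (c : ℤ) : twoRho (fun _ : Fin n => c) = 0 := by
  rw [twoRho, ← Finset.sum_mul, sum_sub_one_sub_two_mul_eq_zero, zero_mul]

/-- **The recursion identity for `2ρ`**: `2⟨ρ_{n+1}, (m, e)⟩ = 2⟨ρ_n, m⟩ + |m| - n e`. [folklore] -/
theorem twoRho_snoc (m : Fin n → ℤ) (e : ℤ) :
    twoRho (Fin.snoc m e : Fin (n + 1) → ℤ) = twoRho m + ∑ i, m i - n * e := by
  rw [twoRho, Fin.sum_univ_castSucc, twoRho, ← Finset.sum_add_distrib]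
  simp only [Fin.snoc_castSucc, Fin.snoc_last, Fin.val_last]
  have h : ∀ i : Fin n, (((n + 1 : ℕ) : ℤ) - 1 - 2 * ((i.castSucc : Fin (n + 1)) : ℕ)) * m i =
      ((n : ℤ) - 1 - 2 * (i : ℕ)) * m i + m i := fun i => by
    rw [Fin.val_castSucc]
    push_cast
    ring
  rw [Finset.sum_congr rfl fun i _ => h i]
  push_cast
  ring

/-- The **weight** `Q^{-2⟨ρ, E⟩}` of an exponent `E ∈ ℤⁿ` (`Q = √q`): the value of
`δ_B^{1/2}(ϖ^E) = q^{-⟨ρ, E⟩}`. [folklore] -/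
def xiWeight (Q : ℝ) (E : Fin n → ℤ) : ℝ := Q ^ (-twoRho E)

/-- The weight is positive for `Q > 0`. [folklore] -/
theorem xiWeight_pos {Q : ℝ} (hQ : 0 < Q) (E : Fin n → ℤ) : 0 < xiWeight Q E :=
  zpow_pos hQ _

/-- The weight is non-negative for `Q ≥ 0`. [folklore] -/
theorem xiWeight_nonneg {Q : ℝ} (hQ : 0 ≤ Q) (E : Fin n → ℤ) : 0 ≤ xiWeight Q E :=
  zpow_nonneg hQ _

/-- The weight of `0` is `1`. [folklore] -/
@[simp]
theorem xiWeight_zero (Q : ℝ) : xiWeight Q (0 : Fin n → ℤ) = 1 := by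
  simp [xiWeight]

/-- **Central invariance of the weight**: `Q^{-2⟨ρ, E + c𝟙⟩} = Q^{-2⟨ρ, E⟩}`. [folklore] -/
theorem xiWeight_add_const (Q : ℝ) (E : Fin n → ℤ) (c : ℤ) :
    xiWeight Q (E + fun _ => c) = xiWeight Q E := by
  rw [xiWeight, xiWeight, twoRho_add, twoRho_const, add_zero]

/-- **The weight factorises along the recursion**:
`Q^{-2⟨ρ_{n+1}, (m, e)⟩} = Q^{-2⟨ρ_n, m⟩} · Q^{-|m| + n e}`. [folklore] -/
theorem xiWeight_snoc {Q : ℝ} (hQ : 0 < Q) (m : Fin n → ℤ) (e : ℤ) :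
    xiWeight Q (Fin.snoc m e : Fin (n + 1) → ℤ) =
      xiWeight Q m * Q ^ (-(∑ i, m i) + n * e) := by
  rw [xiWeight, xiWeight, twoRho_snoc, ← zpow_add₀ hQ.ne']
  congr 1
  ring

end Weight

/-! ### Bordered matrices in `GL_{n+1}(F)` -/

section CornerGL

variable {F : Type*} [Field F] {n : ℕ}

/-- `[[y, x], [0, d]] ∈ GL_{n+1}(F)` for `y ∈ GL_n(F)` and `d ≠ 0`. [folklore] -/
def cornerExtGL (y : GL (Fin n) F) (x : Fin n → F) (d : F) (hd : d ≠ 0) : GL (Fin (n + 1)) F :=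
  Matrix.GeneralLinearGroup.mkOfDetNeZero (cornerExt (y : Matrix (Fin n) (Fin n) F) x d) (by
    rw [det_cornerExt]
    exact mul_ne_zero hd (Matrix.GeneralLinearGroup.det_ne_zero y))

/-- The matrix of `cornerExtGL`. [folklore] -/
@[simp]
theorem coe_cornerExtGL (y : GL (Fin n) F) (x : Fin n → F) (d : F) (hd : d ≠ 0) :
    ((cornerExtGL y x d hd : GL (Fin (n + 1)) F) : Matrix (Fin (n + 1)) (Fin (n + 1)) F) =
      cornerExt (y : Matrix (Fin n) (Fin n) F) x d :=
  rfl

/-- Products of bordered elements of `GL_{n+1}(F)`. [folklore] -/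
theorem cornerExtGL_mul (y y' : GL (Fin n) F) (x x' : Fin n → F) (d d' : F) (hd : d ≠ 0)
    (hd' : d' ≠ 0) :
    cornerExtGL y x d hd * cornerExtGL y' x' d' hd' =
      cornerExtGL (y * y') ((y : Matrix (Fin n) (Fin n) F) *ᵥ x' + d' • x) (d * d')
        (mul_ne_zero hd hd') := by
  refine Units.ext ?_
  rw [Units.val_mul, coe_cornerExtGL, coe_cornerExtGL, coe_cornerExtGL, cornerExt_mul,
    Units.val_mul]

/-- `[[1, 0], [0, 1]] = 1`. [folklore] -/
theorem cornerExtGL_one : cornerExtGL (1 : GL (Fin n) F) 0 1 one_ne_zero = 1 := by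
  refine Units.ext ?_
  rw [coe_cornerExtGL, Units.val_one, cornerExt_one_zero_one, Units.val_one]

variable [ValuativeRel F]

/-- `[[k, x], [0, d]] ∈ GL_{n+1}(𝒪)` for `k ∈ GL_n(𝒪)`, `x` integral and `|d| = 1`. [folklore] -/
theorem cornerExtGL_mem_glInt {k : GL (Fin n) F} (hk : k ∈ glInt n F) {x : Fin n → F}
    (hx : ∀ i, x i ∈ 𝒪[F]) {d : F} (hd : valuation F d = 1) :
    cornerExtGL k x d (by rintro rfl; rw [map_zero] at hd; exact zero_ne_one hd) ∈
      glInt (n + 1) F := by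
  refine mem_glInt_of_isIntegralMatrix ?_ ?_
  · intro i j
    rw [coe_cornerExtGL]
    refine Fin.lastCases ?_ (fun i' => ?_) i <;> refine Fin.lastCases ?_ (fun j' => ?_) j
    · rw [cornerExt_apply_last_last]
      exact (Valuation.mem_integer_iff _ _).2 hd.le
    · rw [cornerExt_apply_last_castSucc]; exact Subring.zero_mem _
    · rw [cornerExt_apply_castSucc_last]; exact hx i'
    · rw [cornerExt_apply_castSucc_castSucc]; exact isIntegralMatrix_of_mem_glInt hk i' j'
  · rw [coe_cornerExtGL, det_cornerExt, map_mul, hd, one_mul, valuation_det_eq_one_of_mem_glInt hk]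

omit [ValuativeRel F] in
/-- `[[u, z], [0, 1]]` is upper unitriangular for `u` upper unitriangular. [folklore] -/
theorem cornerExtGL_mem_upperUnitriangular {u : GL (Fin n) F}
    (hu : u ∈ upperUnitriangular (Fin n) F) (z : Fin n → F) :
    cornerExtGL u z 1 one_ne_zero ∈ upperUnitriangular (Fin (n + 1)) F := by
  rw [mem_upperUnitriangular_iff] at hu ⊢
  refine ⟨?_, fun i => ?_⟩
  · rw [coe_cornerExtGL]
    exact blockTriangular_cornerExt hu.1 z 1
  · rw [coe_cornerExtGL, cornerExt_apply_self]
    refine Fin.lastCases ?_ (fun i' => ?_) i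
    · simp
    · simpa using hu.2 i'

omit [ValuativeRel F] in
/-- `ϖ^{(m, e)} = [[ϖ^m, 0], [0, ϖ^e]]`. [folklore] -/
theorem zpowDiagGL_snoc {ϖ : F} (hϖ : ϖ ≠ 0) (m : Fin n → ℤ) (e : ℤ) :
    zpowDiagGL hϖ (Fin.snoc m e : Fin (n + 1) → ℤ) =
      cornerExtGL (zpowDiagGL hϖ m) 0 (ϖ ^ e) (zpow_ne_zero e hϖ) := by
  refine Units.ext ?_
  rw [coe_zpowDiagGL, coe_cornerExtGL, coe_zpowDiagGL]
  ext i j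
  refine Fin.lastCases ?_ (fun i' => ?_) i <;> refine Fin.lastCases ?_ (fun j' => ?_) j
  · simp
  · simp [(Fin.castSucc_lt_last j').ne']
  · simp [(Fin.castSucc_lt_last i').ne]
  · simp [Matrix.diagonal_apply]

omit [ValuativeRel F] in
/-- `ϖ^{(a, e)} = [[ϖ^a, 0], [0, ϖ^e]]` for natural exponents (`piPowGL`). [folklore] -/
theorem piPowGL_snoc {ϖ : F} (hϖ : ϖ ≠ 0) (a : Fin n → ℕ) (e : ℕ) :
    piPowGL hϖ (Fin.snoc a e : Fin (n + 1) → ℕ) =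
      cornerExtGL (piPowGL hϖ a) 0 (ϖ ^ e) (pow_ne_zero e hϖ) := by
  have h := zpowDiagGL_snoc hϖ (fun i => (a i : ℤ)) (e : ℤ)
  rw [zpowDiagGL_natCast] at h
  have hs : (Fin.snoc (fun i => (a i : ℤ)) (e : ℤ) : Fin (n + 1) → ℤ) =
      fun i => ((Fin.snoc a e : Fin (n + 1) → ℕ) i : ℤ) := by
    funext i
    refine Fin.lastCases ?_ (fun i' => ?_) i <;> simp
  rw [hs, zpowDiagGL_natCast] at h
  rw [h]
  congr 1
  exact zpow_natCast ϖ e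

end CornerGL

/-! ### The Iwasawa exponent of a bordered matrix -/

section CornerIwasawa

variable {F : Type*} [Field F] [ValuativeRel F] {n : ℕ} [IsDiscreteValuationRing 𝒪[F]] {ϖ : F}
  (hϖ : IsUniformizingElement ϖ)
include hϖ

/-- **Iwasawa exponent of a bordered matrix**: `e([[y, x], [0, ϖ^e]]) = (e(y), e)`, since for
`y = u ϖ^m k` one has `[[y, x], [0, ϖ^e]] = [[u, ϖ^{-e} x], [0, 1]] · ϖ^{(m, e)} · [[k, 0], [0, 1]]`.
[folklore] -/
theorem iwasawaExp_cornerExtGL (y : GL (Fin n) F) (x : Fin n → F) (e : ℤ) :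
    iwasawaExp hϖ (cornerExtGL y x (ϖ ^ e) (zpow_ne_zero e hϖ.ne_zero)) =
      Fin.snoc (iwasawaExp hϖ y) e := by
  obtain ⟨u, hu, k, hk, hy⟩ := iwasawaExp_spec hϖ y
  set m := iwasawaExp hϖ y with hm
  refine iwasawaExp_eq hϖ (cornerExtGL_mem_upperUnitriangular hu ((ϖ ^ (-e)) • x))
    (cornerExtGL_mem_glInt hk (x := 0) (fun _ => Subring.zero_mem _) (map_one _)) ?_
  rw [zpowDiagGL_snoc, cornerExtGL_mul, cornerExtGL_mul]
  refine Units.ext ?_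
  simp only [coe_cornerExtGL, Units.val_mul]
  congr 1
  · rw [hy, Units.val_mul, Units.val_mul]
  · rw [Matrix.mulVec_zero, zero_add, Matrix.mulVec_zero, zero_add, one_smul, smul_smul,
      ← zpow_add₀ hϖ.ne_zero, add_neg_cancel, zpow_zero, one_smul]
  · rw [one_mul, mul_one]

/-- `e([[y, x], [0, ϖ^e]]) = (e(y), e)` for a natural exponent `e`. [folklore] -/
theorem iwasawaExp_cornerExtGL_pow (y : GL (Fin n) F) (x : Fin n → F) (e : ℕ) :
    iwasawaExp hϖ (cornerExtGL y x (ϖ ^ e) (pow_ne_zero e hϖ.ne_zero)) =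
      Fin.snoc (iwasawaExp hϖ y) (e : ℤ) := by
  have h := iwasawaExp_cornerExtGL hϖ y x (e : ℤ)
  have hE : cornerExtGL y x (ϖ ^ (e : ℤ)) (zpow_ne_zero (e : ℤ) hϖ.ne_zero) =
      cornerExtGL y x (ϖ ^ e) (pow_ne_zero e hϖ.ne_zero) := by
    congr 1
    exact zpow_natCast ϖ e
  rwa [hE] at h

/-- **The weight of a bordered coset**:
`Q^{-2⟨ρ_{n+1}, e([[y, x], [0, ϖ^e]])⟩} = Q^{-2⟨ρ_n, e(y)⟩} Q^{-|e(y)| + n e}`. [folklore] -/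
theorem xiWeight_iwasawaExp_cornerExtGL {Q : ℝ} (hQ : 0 < Q) (y : GL (Fin n) F) (x : Fin n → F)
    (e : ℤ) :
    xiWeight Q (iwasawaExp hϖ (cornerExtGL y x (ϖ ^ e) (zpow_ne_zero e hϖ.ne_zero))) =
      xiWeight Q (iwasawaExp hϖ y) * Q ^ (-(∑ i, iwasawaExp hϖ y i) + n * e) := by
  rw [iwasawaExp_cornerExtGL hϖ, xiWeight_snoc hQ]

omit [ValuativeRel F] [IsDiscreteValuationRing 𝒪[F]] hϖ in
/-- `∏_i a^{f i} = a^{∑ f i}` for `a ≠ 0` in a commutative group with zero. [folklore] -/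
theorem prod_zpow_eq_zpow_sum_of_ne_zero {G ι : Type*} [CommGroupWithZero G] {a : G} (ha : a ≠ 0)
    (s : Finset ι) (f : ι → ℤ) : ∏ i ∈ s, a ^ f i = a ^ ∑ i ∈ s, f i := by
  classical
  induction s using Finset.induction_on with
  | empty => simp
  | insert i s hi ih => rw [Finset.prod_insert hi, Finset.sum_insert hi, ih, zpow_add₀ ha]

/-- **The trace of the Iwasawa exponent is the determinant valuation**:
`|det y| = |ϖ|^{∑_i e(y)_i}`. [folklore] -/
theorem valuation_det_eq_zpow_sum_iwasawaExp (y : GL (Fin n) F) :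
    valuation F (y : Matrix (Fin n) (Fin n) F).det = valuation F ϖ ^ (∑ i, iwasawaExp hϖ y i) := by
  obtain ⟨u, hu, k, hk, hy⟩ := iwasawaExp_spec hϖ y
  set m := iwasawaExp hϖ y with hm
  have hdu : valuation F (u : Matrix (Fin n) (Fin n) F).det = 1 := by
    rw [Matrix.det_of_upperTriangular ((mem_upperUnitriangular_iff u).1 hu).1]
    rw [Finset.prod_congr rfl fun i _ => ((mem_upperUnitriangular_iff u).1 hu).2 i,
      Finset.prod_const_one, map_one]
  conv_lhs => rw [hy]
  rw [Units.val_mul, Units.val_mul, Matrix.det_mul, Matrix.det_mul, map_mul, map_mul, hdu, one_mul,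
    valuation_det_eq_one_of_mem_glInt hk, mul_one, coe_zpowDiagGL, Matrix.det_diagonal, map_prod]
  simp only [map_zpow₀]
  exact prod_zpow_eq_zpow_sum_of_ne_zero ((Valuation.ne_zero_iff _).2 hϖ.ne_zero) _ _

omit [IsDiscreteValuationRing 𝒪[F]] in
/-- `z ↦ |ϖ|^z` is injective on `ℤ`. [folklore] -/
theorem valuation_zpow_injective : Function.Injective fun z : ℤ => valuation F ϖ ^ z := by
  have h0 : 0 < valuation F ϖ := (Valuation.pos_iff _).2 hϖ.ne_zero
  have h1 : valuation F ϖ < 1 := hϖ.valuation_lt_one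
  exact (zpow_right_strictAnti₀ h0 h1).injective

/-- **The sum of the Iwasawa exponents on `Δ_m` is `m`.** [folklore] -/
theorem iwasawaExp_sum_eq_of_mem_glIntDet {y : GL (Fin n) F} {m : ℕ} (hy : y ∈ glIntDet n ϖ m) :
    ∑ i, iwasawaExp hϖ y i = m := by
  apply valuation_zpow_injective hϖ
  dsimp only
  rw [← valuation_det_eq_zpow_sum_iwasawaExp hϖ y, hy.2, zpow_natCast]

end CornerIwasawa

/-! ### The Harish-Chandra sum `Ξ(g) · #(KgK/K)` -/

section XiSum

variable {F : Type*} [Field F] [ValuativeRel F] {n : ℕ} [IsDiscreteValuationRing 𝒪[F]] {ϖ : F}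
  (hϖ : IsUniformizingElement ϖ)

/-- **The Harish-Chandra sum** `Ξ(g) · #(KgK/K) = ∑_{c ∈ K·gK ⊆ G/K} Q^{-2⟨ρ, e(c)⟩}`, the sum of
the Iwasawa weights `δ_B^{1/2}` over the left cosets in the double coset of `g`
(`= #(KgK/K) ∫_K δ_B(a(kg))^{1/2} dk`; Harish-Chandra's `Ξ`, Cartier (1979) §IV, Macdonald (1971)).
A `finsum`: `0` if the orbit is infinite (it never is for a Hecke pair). [folklore] -/
def xiSum (Q : ℝ) (g : GL (Fin n) F) : ℝ :=
  ∑ᶠ c ∈ orbit (glInt n F) (g : GL (Fin n) F ⧸ glInt n F), xiWeight Q (iwasawaExp hϖ c.out)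

/-- `xiSum` as a finite sum. [folklore] -/
theorem xiSum_eq_sum (Q : ℝ) {g : GL (Fin n) F}
    (hfin : (orbit (glInt n F) (g : GL (Fin n) F ⧸ glInt n F)).Finite) :
    xiSum hϖ Q g = ∑ c ∈ hfin.toFinset, xiWeight Q (iwasawaExp hϖ c.out) :=
  finsum_mem_eq_finite_toFinset_sum _ hfin

/-- `xiSum ≥ 0`. [folklore] -/
theorem xiSum_nonneg {Q : ℝ} (hQ : 0 ≤ Q) (g : GL (Fin n) F) : 0 ≤ xiSum hϖ Q g :=
  finsum_nonneg fun _ => finsum_nonneg fun _ => xiWeight_nonneg hQ _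

/-- `xiSum` only depends on the `K`-orbit of `gK`, i.e. on the double coset `KgK`. [folklore] -/
theorem xiSum_eq_of_mem_orbit (Q : ℝ) {g g' : GL (Fin n) F}
    (h : (g' : GL (Fin n) F ⧸ glInt n F) ∈ orbit (glInt n F) (g : GL (Fin n) F ⧸ glInt n F)) :
    xiSum hϖ Q g' = xiSum hϖ Q g := by
  unfold xiSum
  rw [(MulAction.orbit_eq_iff.2 h)]

/-- `xiSum (k₁ g k₂) = xiSum g` for `k₁, k₂ ∈ K`. [folklore] -/
theorem xiSum_glInt_mul_mul_glInt (Q : ℝ) {g k₁ k₂ : GL (Fin n) F} (hk₁ : k₁ ∈ glInt n F)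
    (hk₂ : k₂ ∈ glInt n F) : xiSum hϖ Q (k₁ * g * k₂) = xiSum hϖ Q g :=
  xiSum_eq_of_mem_orbit hϖ Q ((heckeAlgebra.coe_mem_orbit_coe_iff _ g _).2 ⟨k₁, hk₁, k₂, hk₂, rfl⟩)

/-- **`xiSum 1 = 1`** (the trivial double coset `K`: the single coset `K` with weight `1`).
[folklore] -/
theorem xiSum_one (Q : ℝ) : xiSum hϖ Q (1 : GL (Fin n) F) = 1 := by
  have horb : orbit (glInt n F) ((1 : GL (Fin n) F) : GL (Fin n) F ⧸ glInt n F) =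
      {((1 : GL (Fin n) F) : GL (Fin n) F ⧸ glInt n F)} := by
    refine Set.ext fun c => ⟨fun hc => ?_, fun hc => ?_⟩
    · obtain ⟨a, ha⟩ := MulAction.mem_orbit_iff.1 hc
      rw [Set.mem_singleton_iff, ← ha, subgroup_smul_mk, mul_one, QuotientGroup.eq, mul_one]
      exact Subgroup.inv_mem _ a.2
    · rw [Set.mem_singleton_iff] at hc
      rw [hc]
      exact MulAction.mem_orbit_self _
  unfold xiSum
  rw [horb, finsum_mem_singleton, iwasawaExp_out_coe, iwasawaExp_one, xiWeight_zero]

end XiSum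

section Finite

variable {F : Type*} [Field F] [ValuativeRel F] {n : ℕ} {ϖ : F} (hϖ : IsUniformizingElement ϖ)
  [Finite 𝓀[F]]
include hϖ

/-- **Finiteness of `KgK/K` for `g` integral** (from the finiteness of `Δ_m K/K`,
`finite_cosets_glIntDet`; no Hecke-pair hypothesis needed). [folklore] -/
theorem finite_orbit_of_mem_glIntDet {g : GL (Fin n) F} {m : ℕ} (hg : g ∈ glIntDet n ϖ m) :
    (orbit (glInt n F) (g : GL (Fin n) F ⧸ glInt n F)).Finite := by
  refine (finite_cosets_glIntDet hϖ m).subset fun _ hc => ?_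
  obtain ⟨a, rfl⟩ := MulAction.mem_orbit_iff.1 hc
  rw [Set.mem_setOf_eq, smul_out_mem_glIntDet_iff, mk_out_mem_glIntDet_iff]
  exact hg

/-- `K ϖ^a K / K` is finite. [folklore] -/
theorem finite_orbit_piPowGL (a : Fin n → ℕ) :
    (orbit (glInt n F) ((piPowGL hϖ.ne_zero a : GL (Fin n) F) : GL (Fin n) F ⧸ glInt n F)).Finite :=
  finite_orbit_of_mem_glIntDet hϖ (piPowGL_mem_glIntDet hϖ a)

end Finite


/-! ### Row reduction: every integral coset is a bordered coset -/

section CornerCoset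

variable {F : Type*} [Field F] [ValuativeRel F] {n : ℕ}

omit [ValuativeRel F] in
/-- `[[y, x], [0, d]] · [[k, 0], [0, 1]] = [[y k, x], [0, d]]`. [folklore] -/
theorem cornerExtGL_mul_corner (y k : GL (Fin n) F) (x : Fin n → F) {d : F} (hd : d ≠ 0) :
    cornerExtGL y x d hd * cornerExtGL k 0 1 one_ne_zero = cornerExtGL (y * k) x d hd := by
  rw [cornerExtGL_mul]
  refine Units.ext ?_
  simp only [coe_cornerExtGL, Matrix.mulVec_zero, zero_add, one_smul, mul_one]

omit [ValuativeRel F] in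
/-- `[[k, 0], [0, 1]] · [[y, x], [0, d]] = [[k y, k x], [0, d]]`. [folklore] -/
theorem corner_mul_cornerExtGL (k y : GL (Fin n) F) (x : Fin n → F) {d : F} (hd : d ≠ 0) :
    cornerExtGL k 0 1 one_ne_zero * cornerExtGL y x d hd =
      cornerExtGL (k * y) ((k : Matrix (Fin n) (Fin n) F) *ᵥ x) d hd := by
  rw [cornerExtGL_mul]
  refine Units.ext ?_
  simp only [coe_cornerExtGL, smul_zero, add_zero, one_mul]

omit [ValuativeRel F] in
/-- `[[k, 0], [0, 1]]⁻¹ = [[k⁻¹, 0], [0, 1]]`. [folklore] -/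
theorem cornerExtGL_corner_inv (k : GL (Fin n) F) :
    (cornerExtGL k 0 1 one_ne_zero)⁻¹ = cornerExtGL k⁻¹ 0 1 one_ne_zero := by
  refine inv_eq_of_mul_eq_one_right ?_
  rw [corner_mul_cornerExtGL, Matrix.mulVec_zero, mul_inv_cancel, cornerExtGL_one]

/-- `k x` is integral for `k ∈ GL_n(𝒪)` and `x` integral. [folklore] -/
theorem mulVec_mem_integer {k : GL (Fin n) F} (hk : k ∈ glInt n F) {x : Fin n → F}
    (hx : ∀ i, x i ∈ 𝒪[F]) (i : Fin n) : ((k : Matrix (Fin n) (Fin n) F) *ᵥ x) i ∈ 𝒪[F] := by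
  rw [Matrix.mulVec, dotProduct]
  exact Subring.sum_mem _ fun j _ => Subring.mul_mem _ (isIntegralMatrix_of_mem_glInt hk i j) (hx j)

/-- Right multiplication by `[[k, 0], [0, 1]]`, `k ∈ GL_n(𝒪)`, does not change the coset.
[folklore] -/
theorem coe_cornerExtGL_mul_glInt (y : GL (Fin n) F) {k : GL (Fin n) F} (hk : k ∈ glInt n F)
    (x : Fin n → F) {d : F} (hd : d ≠ 0) :
    ((cornerExtGL (y * k) x d hd : GL (Fin (n + 1)) F) : GL (Fin (n + 1)) F ⧸ glInt (n + 1) F) =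
      (cornerExtGL y x d hd : GL (Fin (n + 1)) F) := by
  rw [← cornerExtGL_mul_corner, QuotientGroup.mk_mul_of_mem]
  exact cornerExtGL_mem_glInt hk (fun _ => Subring.zero_mem _) (map_one _)

/-- **Changing the column modulo `y 𝒪ⁿ` does not change the coset**:
`[[y, y z + x'], [0, d]] K = [[y, x'], [0, d]] K` for `z` integral. [folklore] -/
theorem coe_cornerExtGL_eq_of_eq_mulVec_add (y : GL (Fin n) F) {x x' z : Fin n → F}
    (hz : ∀ i, z i ∈ 𝒪[F]) (h : x = (y : Matrix (Fin n) (Fin n) F) *ᵥ z + x') {d : F} (hd : d ≠ 0) :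
    ((cornerExtGL y x d hd : GL (Fin (n + 1)) F) : GL (Fin (n + 1)) F ⧸ glInt (n + 1) F) =
      (cornerExtGL y x' d hd : GL (Fin (n + 1)) F) := by
  have hE : cornerExtGL y x d hd = cornerExtGL y x' d hd * cornerExtGL 1 z 1 one_ne_zero := by
    rw [cornerExtGL_mul]
    refine Units.ext ?_
    simp only [coe_cornerExtGL, mul_one, one_smul, h]
  rw [hE, QuotientGroup.mk_mul_of_mem]
  exact cornerExtGL_mem_glInt (Subgroup.one_mem _) hz (map_one _)

end CornerCoset

/-! ### Row reduction: every integral coset is a bordered coset -/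

section RowReduction

variable {F : Type*} [Field F] [ValuativeRel F] {n : ℕ} [IsDiscreteValuationRing 𝒪[F]] {ϖ : F}
  (hϖ : IsUniformizingElement ϖ)
include hϖ

/-- In a discrete valuation field, an integral `d ≠ 0` is `ϖ^e · w` with `e ∈ ℕ` and `|w| = 1`.
[folklore] -/
theorem exists_eq_pow_mul_of_mem_integer {d : F} (hd : d ∈ 𝒪[F]) (hd0 : d ≠ 0) :
    ∃ (e : ℕ) (w : F), valuation F w = 1 ∧ d = ϖ ^ e * w := by
  obtain ⟨a, w, hw, hdw⟩ := exists_eq_zpow_mul_of_ne_zero hϖ hd0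
  have ha : 0 ≤ a := by
    by_contra ha
    rw [not_le] at ha
    have h1 : valuation F d ≤ 1 := (Valuation.mem_integer_iff _ _).1 hd
    rw [hdw, map_mul, hw, mul_one, map_zpow₀] at h1
    have h2 : valuation F ϖ ^ (0 : ℤ) < valuation F ϖ ^ a :=
      zpow_right_strictAnti₀ ((Valuation.pos_iff _).2 hϖ.ne_zero) hϖ.valuation_lt_one ha
    rw [zpow_zero] at h2
    exact absurd h1 (not_le.2 h2)
  obtain ⟨e, rfl⟩ := Int.eq_ofNat_of_zero_le ha
  exact ⟨e, w, hw, by rw [hdw, zpow_natCast]⟩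

/-- **Row reduction.** Every integral `g ∈ GL_{n+1}(F)` has `g K = [[y, x], [0, ϖ^e]] K` with
`y ∈ GL_n(F)` integral, `x ∈ 𝒪ⁿ` and `e ∈ ℕ`: clear the last row by a column operation in
`GL_{n+1}(𝒪)` (`exists_mul_glInt_isRowTriangularFrom`) and normalise the corner entry by a
diagonal unit. [folklore] -/
theorem exists_coe_eq_cornerExtGL {g : GL (Fin (n + 1)) F}
    (hg : IsIntegralMatrix (g : Matrix (Fin (n + 1)) (Fin (n + 1)) F)) :
    ∃ (y : GL (Fin n) F) (x : Fin n → F) (e : ℕ),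
      IsIntegralMatrix (y : Matrix (Fin n) (Fin n) F) ∧ (∀ i, x i ∈ 𝒪[F]) ∧
      (g : GL (Fin (n + 1)) F ⧸ glInt (n + 1) F) =
        (cornerExtGL y x (ϖ ^ e) (pow_ne_zero e hϖ.ne_zero) : GL (Fin (n + 1)) F) := by
  -- clear the last row
  obtain ⟨k, hk, htri⟩ := exists_mul_glInt_isRowTriangularFrom g (Fin.last n)
    (isRowTriangularFrom_of_le (by rw [Fin.val_last]))
  set M : Matrix (Fin (n + 1)) (Fin (n + 1)) F :=
    ((g * k : GL (Fin (n + 1)) F) : Matrix (Fin (n + 1)) (Fin (n + 1)) F) with hM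
  have hMint : IsIntegralMatrix M := by
    rw [hM, Units.val_mul]; exact hg.mul (isIntegralMatrix_of_mem_glInt hk)
  have hrow : ∀ j : Fin n, M (Fin.last n) j.castSucc = 0 := fun j =>
    htri (Fin.last n) j.castSucc le_rfl (Fin.castSucc_lt_last j)
  -- the corner entry `d = ϖ^e w`
  set d : F := M (Fin.last n) (Fin.last n) with hd
  have hd0 : d ≠ 0 := by
    intro h0
    refine Matrix.GeneralLinearGroup.det_ne_zero (g * k) (Matrix.det_eq_zero_of_row_eq_zero
      (Fin.last n) fun j => ?_)
    refine Fin.lastCases ?_ (fun j' => ?_) j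
    · exact h0
    · exact hrow j'
  obtain ⟨e, w, hw, hdw⟩ := exists_eq_pow_mul_of_mem_integer hϖ (hMint _ _) hd0
  have hw0 : w ≠ 0 := by rintro rfl; rw [map_zero] at hw; exact zero_ne_one hw
  have hwinv : valuation F w⁻¹ = 1 := by rw [map_inv₀, hw, inv_one]
  -- the correcting unit `κ = [[1, 0], [0, w⁻¹]]`
  have hκ : cornerExtGL (1 : GL (Fin n) F) 0 w⁻¹ (inv_ne_zero hw0) ∈ glInt (n + 1) F :=
    cornerExtGL_mem_glInt (Subgroup.one_mem _) (fun _ => Subring.zero_mem _) hwinv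
  set N : Matrix (Fin (n + 1)) (Fin (n + 1)) F :=
    ((g * k * cornerExtGL (1 : GL (Fin n) F) 0 w⁻¹ (inv_ne_zero hw0) : GL (Fin (n + 1)) F) :
      Matrix (Fin (n + 1)) (Fin (n + 1)) F) with hN
  have hNM : N = M * cornerExt (1 : Matrix (Fin n) (Fin n) F) 0 w⁻¹ := by
    rw [hN, Units.val_mul, coe_cornerExtGL, Units.val_one]
  have hNint : IsIntegralMatrix N := by
    rw [hN, Units.val_mul]
    exact hMint.mul (isIntegralMatrix_of_mem_glInt hκ)
  have hN_last_castSucc : ∀ j : Fin n, N (Fin.last n) j.castSucc = 0 := by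
    intro j
    rw [hNM, Matrix.mul_apply, Fin.sum_univ_castSucc]
    simp only [cornerExt_apply_castSucc_castSucc, cornerExt_apply_last_castSucc, mul_zero, add_zero]
    exact Finset.sum_eq_zero fun l _ => by rw [hrow l, zero_mul]
  have hN_last_last : N (Fin.last n) (Fin.last n) = ϖ ^ e := by
    rw [hNM, Matrix.mul_apply, Fin.sum_univ_castSucc]
    simp only [cornerExt_apply_castSucc_last, Pi.zero_apply, mul_zero, Finset.sum_const_zero,
      zero_add, cornerExt_apply_last_last]
    rw [hdw, mul_assoc, mul_inv_cancel₀ hw0, mul_one]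
  -- the blocks of `N`
  set Y : Matrix (Fin n) (Fin n) F := N.submatrix Fin.castSucc Fin.castSucc with hY
  set x : Fin n → F := fun i => N i.castSucc (Fin.last n) with hx
  have hNeq : N = cornerExt Y x (ϖ ^ e) := by
    ext i j
    refine Fin.lastCases ?_ (fun i' => ?_) i <;> refine Fin.lastCases ?_ (fun j' => ?_) j
    · rw [cornerExt_apply_last_last, hN_last_last]
    · rw [cornerExt_apply_last_castSucc, hN_last_castSucc]
    · rw [cornerExt_apply_castSucc_last]
    · rw [cornerExt_apply_castSucc_castSucc, hY, Matrix.submatrix_apply]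
  have hdetY : Y.det ≠ 0 := by
    have h := Matrix.GeneralLinearGroup.det_ne_zero
      (g * k * cornerExtGL (1 : GL (Fin n) F) 0 w⁻¹ (inv_ne_zero hw0))
    rw [← hN, hNeq, det_cornerExt] at h
    exact right_ne_zero_of_mul h
  refine ⟨Matrix.GeneralLinearGroup.mkOfDetNeZero Y hdetY, x, e, fun i j => hNint _ _,
    fun i => hNint _ _, ?_⟩
  rw [QuotientGroup.eq]
  have hE : cornerExtGL (Matrix.GeneralLinearGroup.mkOfDetNeZero Y hdetY) x (ϖ ^ e)
      (pow_ne_zero e hϖ.ne_zero) = g * k * cornerExtGL (1 : GL (Fin n) F) 0 w⁻¹ (inv_ne_zero hw0) :=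
    Units.ext (by rw [coe_cornerExtGL]; exact hNeq.symm.trans hN)
  rw [hE, mul_assoc, inv_mul_cancel_left]
  exact Subgroup.mul_mem _ hk hκ

end RowReduction

/-! ### The fibres of the bordered cosets inside `K ϖ^λ K` -/

section Fibre

variable {F : Type*} [Field F] [ValuativeRel F] {n : ℕ} [IsDiscreteValuationRing 𝒪[F]] {ϖ : F}
  (hϖ : IsUniformizingElement ϖ)

/-- **The fibre** over `y ∈ GL_n(F)` of the cosets `[[y, x], [0, ϖ^e]] K ⊆ K ϖ^λ K` of
`GL_{n+1}(F)` with `x` integral (as a set of left cosets). [folklore] -/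
def xiFib (lam : Fin (n + 1) → ℕ) (y : GL (Fin n) F) : Set (GL (Fin (n + 1)) F ⧸ glInt (n + 1) F) :=
  {c | c ∈ orbit (glInt (n + 1) F)
      ((piPowGL hϖ.ne_zero lam : GL (Fin (n + 1)) F) : GL (Fin (n + 1)) F ⧸ glInt (n + 1) F) ∧
    ∃ (x : Fin n → F) (e : ℕ), (∀ i, x i ∈ 𝒪[F]) ∧
      c = (cornerExtGL y x (ϖ ^ e) (pow_ne_zero e hϖ.ne_zero) : GL (Fin (n + 1)) F)}

omit [IsDiscreteValuationRing 𝒪[F]] in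
/-- Membership in the fibre. [folklore] -/
theorem mem_xiFib_iff {lam : Fin (n + 1) → ℕ} {y : GL (Fin n) F}
    {c : GL (Fin (n + 1)) F ⧸ glInt (n + 1) F} :
    c ∈ xiFib hϖ lam y ↔ c ∈ orbit (glInt (n + 1) F)
      ((piPowGL hϖ.ne_zero lam : GL (Fin (n + 1)) F) : GL (Fin (n + 1)) F ⧸ glInt (n + 1) F) ∧
    ∃ (x : Fin n → F) (e : ℕ), (∀ i, x i ∈ 𝒪[F]) ∧
      c = (cornerExtGL y x (ϖ ^ e) (pow_ne_zero e hϖ.ne_zero) : GL (Fin (n + 1)) F) :=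
  Iff.rfl

omit [IsDiscreteValuationRing 𝒪[F]] in
/-- The fibre lies in `K ϖ^λ K / K`. [folklore] -/
theorem xiFib_subset_orbit (lam : Fin (n + 1) → ℕ) (y : GL (Fin n) F) :
    xiFib hϖ lam y ⊆ orbit (glInt (n + 1) F)
      ((piPowGL hϖ.ne_zero lam : GL (Fin (n + 1)) F) : GL (Fin (n + 1)) F ⧸ glInt (n + 1) F) :=
  fun _ hc => hc.1

omit [IsDiscreteValuationRing 𝒪[F]] in
/-- **Right invariance of the fibres**: `xiFib λ (y k) = xiFib λ y` for `k ∈ GL_n(𝒪)`. [folklore] -/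
theorem xiFib_mul_glInt (lam : Fin (n + 1) → ℕ) (y : GL (Fin n) F) {k : GL (Fin n) F}
    (hk : k ∈ glInt n F) : xiFib hϖ lam (y * k) = xiFib hϖ lam y := by
  ext c
  simp only [mem_xiFib_iff, coe_cornerExtGL_mul_glInt y hk]

omit [IsDiscreteValuationRing 𝒪[F]] in
/-- **Left invariance of the fibre counts**: `#xiFib λ (k y) = #xiFib λ y` for `k ∈ GL_n(𝒪)`
(translate by `[[k, 0], [0, 1]] ∈ GL_{n+1}(𝒪)`). [folklore] -/
theorem ncard_xiFib_glInt_mul (lam : Fin (n + 1) → ℕ) (y : GL (Fin n) F) {k : GL (Fin n) F}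
    (hk : k ∈ glInt n F) : (xiFib hϖ lam (k * y)).ncard = (xiFib hϖ lam y).ncard := by
  set E : GL (Fin (n + 1)) F := cornerExtGL k 0 1 one_ne_zero with hE
  have hEK : E ∈ glInt (n + 1) F :=
    cornerExtGL_mem_glInt hk (fun _ => Subring.zero_mem _) (map_one _)
  -- translation by an element of `K` preserves `K`-orbits
  have horb : ∀ {c p : GL (Fin (n + 1)) F ⧸ glInt (n + 1) F} {a : GL (Fin (n + 1)) F},
      a ∈ glInt (n + 1) F → c ∈ orbit (glInt (n + 1) F) p → a • c ∈ orbit (glInt (n + 1) F) p := by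
    intro c p a ha hc
    obtain ⟨b, rfl⟩ := MulAction.mem_orbit_iff.1 hc
    exact MulAction.mem_orbit_iff.2 ⟨⟨a, ha⟩ * b, by rw [mul_smul]; rfl⟩
  have himage : xiFib hϖ lam (k * y) = (fun c => E • c) '' xiFib hϖ lam y := by
    ext c
    simp only [Set.mem_image]
    constructor
    · rintro ⟨hc, x, e, hx, rfl⟩
      refine ⟨E⁻¹ • (cornerExtGL (k * y) x (ϖ ^ e) (pow_ne_zero e hϖ.ne_zero) :
          GL (Fin (n + 1)) F ⧸ glInt (n + 1) F), ⟨horb (Subgroup.inv_mem _ hEK) hc, ?_⟩,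
          smul_inv_smul _ _⟩
      refine ⟨((k⁻¹ : GL (Fin n) F) : Matrix (Fin n) (Fin n) F) *ᵥ x, e,
        mulVec_mem_integer (Subgroup.inv_mem _ hk) hx, ?_⟩
      rw [hE, cornerExtGL_corner_inv, MulAction.Quotient.smul_mk, smul_eq_mul,
        corner_mul_cornerExtGL, inv_mul_cancel_left]
    · rintro ⟨c₀, ⟨hc₀, x, e, hx, rfl⟩, rfl⟩
      refine ⟨horb hEK hc₀, (k : Matrix (Fin n) (Fin n) F) *ᵥ x, e, mulVec_mem_integer hk hx, ?_⟩
      rw [hE, MulAction.Quotient.smul_mk, smul_eq_mul, corner_mul_cornerExtGL]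
  rw [himage, Set.ncard_image_of_injective _ (MulAction.injective E)]

omit [IsDiscreteValuationRing 𝒪[F]] in
/-- **The exponent of a bordered coset in `K ϖ^λ K`**: if `[[y, x], [0, ϖ^e]] K ⊆ K ϖ^λ K` and
`y ∈ Δ_{m'}` then `e + m' = |λ|` (determinants). [folklore] -/
theorem add_eq_sum_of_coe_cornerExtGL_mem_orbit {lam : Fin (n + 1) → ℕ} {y : GL (Fin n) F} {m' : ℕ}
    (hy : y ∈ glIntDet n ϖ m') {x : Fin n → F} {e : ℕ}
    (hc : ((cornerExtGL y x (ϖ ^ e) (pow_ne_zero e hϖ.ne_zero) : GL (Fin (n + 1)) F) :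
        GL (Fin (n + 1)) F ⧸ glInt (n + 1) F) ∈ orbit (glInt (n + 1) F)
      ((piPowGL hϖ.ne_zero lam : GL (Fin (n + 1)) F) : GL (Fin (n + 1)) F ⧸ glInt (n + 1) F)) :
    e + m' = ∑ j, lam j := by
  obtain ⟨a, ha, b, hb, hab⟩ := (heckeAlgebra.coe_mem_orbit_coe_iff _ _ _).1 hc
  have hmem : cornerExtGL y x (ϖ ^ e) (pow_ne_zero e hϖ.ne_zero) ∈ glIntDet (n + 1) ϖ (∑ j, lam j) := by
    rw [hab, mul_glInt_mem_glIntDet_iff hb, glInt_mul_mem_glIntDet_iff ha]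
    exact piPowGL_mem_glIntDet hϖ lam
  apply valuation_pow_injective hϖ
  dsimp only
  rw [← hmem.2, coe_cornerExtGL, det_cornerExt, map_mul, map_pow, hy.2, pow_add]

/-- **The weight on a fibre**: for `c = [[y, x], [0, ϖ^e]] K` in the fibre of `y ∈ K ϖ^{λ'} K`
inside `K ϖ^λ K`, `Q^{-2⟨ρ_{n+1}, e(c)⟩} = Q^{-2⟨ρ_n, e(y)⟩} · Q^{n|λ| - (n+1)|λ'|}`. [folklore] -/
theorem xiWeight_of_mem_xiFib {Q : ℝ} (hQ : 0 < Q) {lam : Fin (n + 1) → ℕ} {lam' : Fin n → ℕ}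
    {y : GL (Fin n) F}
    (hy : (y : GL (Fin n) F ⧸ glInt n F) ∈ orbit (glInt n F)
      ((piPowGL hϖ.ne_zero lam' : GL (Fin n) F) : GL (Fin n) F ⧸ glInt n F))
    {c : GL (Fin (n + 1)) F ⧸ glInt (n + 1) F} (hc : c ∈ xiFib hϖ lam y) :
    xiWeight Q (iwasawaExp hϖ c.out) = xiWeight Q (iwasawaExp hϖ y) *
      Q ^ ((n : ℤ) * (∑ j, lam j : ℕ) - ((n : ℤ) + 1) * (∑ i, lam' i : ℕ)) := by
  obtain ⟨hco, x, e, -, rfl⟩ := hc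
  obtain ⟨a, ha, b, hb, hab⟩ := (heckeAlgebra.coe_mem_orbit_coe_iff _ _ _).1 hy
  have hy' : y ∈ glIntDet n ϖ (∑ i, lam' i) := by
    rw [hab, mul_glInt_mem_glIntDet_iff hb, glInt_mul_mem_glIntDet_iff ha]
    exact piPowGL_mem_glIntDet hϖ lam'
  have he := add_eq_sum_of_coe_cornerExtGL_mem_orbit hϖ hy' hco
  rw [iwasawaExp_out_coe, iwasawaExp_cornerExtGL_pow hϖ, xiWeight_snoc hQ,
    iwasawaExp_sum_eq_of_mem_glIntDet hϖ hy']
  congr 1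
  have he' : (e : ℤ) = ((∑ j, lam j : ℕ) : ℤ) - ((∑ i, lam' i : ℕ) : ℤ) := by
    rw [← he]; push_cast; ring
  rw [he']
  ring

/-- **The fibres cover `K ϖ^λ K / K`**: every coset in `K ϖ^λ K` lies in the fibre over the
chosen representative of some coset in some `K ϖ^{λ'} K ⊆ GL_n(F)` with `λ'` antitone and
`|λ'| ≤ |λ|` (row reduction, then the Cartan decomposition of the corner). [folklore] -/
theorem exists_mem_xiFib_out (lam : Fin (n + 1) → ℕ) {c : GL (Fin (n + 1)) F ⧸ glInt (n + 1) F}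
    (hc : c ∈ orbit (glInt (n + 1) F)
      ((piPowGL hϖ.ne_zero lam : GL (Fin (n + 1)) F) : GL (Fin (n + 1)) F ⧸ glInt (n + 1) F)) :
    ∃ lam' : Fin n → ℕ, Antitone lam' ∧ ∑ i, lam' i ≤ ∑ j, lam j ∧
      ∃ c' ∈ orbit (glInt n F) ((piPowGL hϖ.ne_zero lam' : GL (Fin n) F) : GL (Fin n) F ⧸ glInt n F),
        c ∈ xiFib hϖ lam c'.out := by
  -- `c.out` is integral
  have hint : c.out ∈ glIntDet (n + 1) ϖ (∑ j, lam j) := by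
    obtain ⟨a, rfl⟩ := MulAction.mem_orbit_iff.1 hc
    rw [smul_out_mem_glIntDet_iff, mk_out_mem_glIntDet_iff]
    exact piPowGL_mem_glIntDet hϖ lam
  obtain ⟨y, x, e, hyint, hx, hcy⟩ := exists_coe_eq_cornerExtGL hϖ hint.1
  rw [QuotientGroup.out_eq'] at hcy
  obtain ⟨k₁, hk₁, k₂, hk₂, lam', hlam', hy⟩ := exists_glInt_mul_mul_eq_piPowGL hϖ hyint
  have hy' : y = k₁⁻¹ * piPowGL hϖ.ne_zero lam' * k₂⁻¹ := by rw [← hy]; group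
  have hyorb : (y : GL (Fin n) F ⧸ glInt n F) ∈ orbit (glInt n F)
      ((piPowGL hϖ.ne_zero lam' : GL (Fin n) F) : GL (Fin n) F ⧸ glInt n F) :=
    (heckeAlgebra.coe_mem_orbit_coe_iff _ _ _).2
      ⟨k₁⁻¹, Subgroup.inv_mem _ hk₁, k₂⁻¹, Subgroup.inv_mem _ hk₂, hy'⟩
  have hydet : y ∈ glIntDet n ϖ (∑ i, lam' i) := by
    rw [hy', mul_glInt_mem_glIntDet_iff (Subgroup.inv_mem _ hk₂),
      glInt_mul_mem_glIntDet_iff (Subgroup.inv_mem _ hk₁)]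
    exact piPowGL_mem_glIntDet hϖ lam'
  have hsum : e + ∑ i, lam' i = ∑ j, lam j :=
    add_eq_sum_of_coe_cornerExtGL_mem_orbit hϖ hydet (hcy ▸ hc)
  refine ⟨lam', hlam', by omega, (y : GL (Fin n) F ⧸ glInt n F), hyorb, ?_⟩
  -- `c'.out = y k` for some `k ∈ K`
  obtain ⟨k, hk⟩ := QuotientGroup.mk_out_eq_mul (glInt n F) y
  rw [hk, xiFib_mul_glInt hϖ lam y k.2]
  exact ⟨hc, x, e, hx, hcy⟩

end Fibre

section FibreFinite

variable {F : Type*} [Field F] [ValuativeRel F] {n : ℕ} {ϖ : F} (hϖ : IsUniformizingElement ϖ)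
  [Finite 𝓀[F]]

/-- The fibre is finite. [folklore] -/
theorem finite_xiFib (lam : Fin (n + 1) → ℕ) (y : GL (Fin n) F) : (xiFib hϖ lam y).Finite :=
  (finite_orbit_piPowGL hϖ lam).subset (xiFib_subset_orbit hϖ lam y)

end FibreFinite

/-! ### Counting: residue systems and the fibre bound -/

section Residues

variable {F : Type*} [Field F] [ValuativeRel F] {ϖ : F} (hϖ : IsUniformizingElement ϖ)
include hϖ

/-- **Residue systems modulo `ϖ^N` of size `≤ q^N`** (`ϖ`-adic digits; the tree's
`exists_finset_residues_pow` of `GodementJacquetAtomsDecomp` with the cardinality recorded).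
[folklore] -/
theorem exists_finset_residues_pow_card_le [Finite 𝓀[F]] (N : ℕ) :
    ∃ R : Finset F, (∀ r ∈ R, r ∈ 𝒪[F]) ∧ R.card ≤ Nat.card 𝓀[F] ^ N ∧
      ∀ x ∈ 𝒪[F], ∃ r ∈ R, valuation F (x - r) ≤ valuation F ϖ ^ N := by
  classical
  haveI := Fintype.ofFinite 𝓀[F]
  induction N with
  | zero =>
    refine ⟨{0}, by simp, by simp, fun x hx => ⟨0, Finset.mem_singleton_self _, ?_⟩⟩
    rw [sub_zero, pow_zero]
    exact (Valuation.mem_integer_iff _ _).mp hx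
  | succ N ih =>
    obtain ⟨R, hR, hcard, hcomplete⟩ := ih
    refine ⟨(R ×ˢ (Finset.univ : Finset 𝓀[F])).image fun p => p.1 + ϖ ^ N * ((liftRes p.2 : 𝒪[F]) : F),
      ?_, ?_, ?_⟩
    · intro r hr
      obtain ⟨⟨r₀, c⟩, hp, rfl⟩ := Finset.mem_image.mp hr
      exact Subring.add_mem _ (hR r₀ (Finset.mem_product.mp hp).1)
        (Subring.mul_mem _ (hϖ.pow_mem N) (SetLike.coe_mem _))
    · refine Finset.card_image_le.trans ?_
      rw [Finset.card_product, Finset.card_univ, ← Nat.card_eq_fintype_card, pow_succ]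
      exact Nat.mul_le_mul_right _ hcard
    · intro x hx
      obtain ⟨r, hr, hxr⟩ := hcomplete x hx
      have hpow : ϖ ^ N ≠ 0 := pow_ne_zero _ hϖ.ne_zero
      have hv : valuation F ϖ ^ N ≠ 0 := pow_ne_zero _ ((Valuation.ne_zero_iff _).2 hϖ.ne_zero)
      set y : F := (ϖ ^ N)⁻¹ * (x - r) with hy
      have hyint : y ∈ 𝒪[F] := by
        rw [Valuation.mem_integer_iff, hy, map_mul, map_inv₀, map_pow]
        calc (valuation F ϖ ^ N)⁻¹ * valuation F (x - r)
            ≤ (valuation F ϖ ^ N)⁻¹ * valuation F ϖ ^ N := mul_le_mul_right hxr _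
          _ = 1 := inv_mul_cancel₀ hv
      set c : 𝓀[F] := IsLocalRing.residue 𝒪[F] ⟨y, hyint⟩ with hc
      refine ⟨r + ϖ ^ N * ((liftRes c : 𝒪[F]) : F), Finset.mem_image.mpr ⟨(r, c),
        Finset.mem_product.mpr ⟨hr, Finset.mem_univ _⟩, rfl⟩, ?_⟩
      have e : x - (r + ϖ ^ N * ((liftRes c : 𝒪[F]) : F)) =
          ϖ ^ N * (y - ((liftRes c : 𝒪[F]) : F)) := by
        rw [hy, mul_sub, ← mul_assoc, mul_inv_cancel₀ hpow, one_mul]; ring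
      have hres : valuation F (y - ((liftRes c : 𝒪[F]) : F)) ≤ valuation F ϖ := by
        have hmem : y - ((liftRes c : 𝒪[F]) : F) ∈ 𝒪[F] := Subring.sub_mem _ hyint (liftRes c).2
        have hlt : valuation F (y - ((liftRes c : 𝒪[F]) : F)) < 1 := by
          have h0 : IsLocalRing.residue 𝒪[F] (⟨y, hyint⟩ - liftRes c) = 0 := by
            rw [map_sub, residue_liftRes, hc, sub_self]
          exact valuation_lt_one_of_residue_eq_zero h0
        obtain ⟨y', hy', hyy'⟩ := hϖ.exists_eq_mul hmem hlt
        rw [hyy', map_mul]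
        exact mul_le_of_le_one_right' ((Valuation.mem_integer_iff _ _).mp hy')
      rw [e, map_mul, map_pow, pow_succ]
      exact mul_le_mul' le_rfl hres

/-- **One `ϖ`-adic digit block**: if `|x| ≤ |ϖ|^b`, `b ≤ m`, and `R` is a residue system modulo
`ϖ^{m-b}`, then `x ≡ ϖ^b r (mod ϖ^m)` for some `r ∈ R`. [folklore] -/
theorem exists_sub_pow_mul_le {x : F} {b m : ℕ} (hb : b ≤ m)
    (hv : valuation F x ≤ valuation F ϖ ^ b) {R : Finset F}
    (hR : ∀ y ∈ 𝒪[F], ∃ r ∈ R, valuation F (y - r) ≤ valuation F ϖ ^ (m - b)) :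
    ∃ r ∈ R, valuation F (x - ϖ ^ b * r) ≤ valuation F ϖ ^ m := by
  have hpow : ϖ ^ b ≠ 0 := pow_ne_zero _ hϖ.ne_zero
  have hvb : valuation F ϖ ^ b ≠ 0 := pow_ne_zero _ ((Valuation.ne_zero_iff _).2 hϖ.ne_zero)
  set w : F := (ϖ ^ b)⁻¹ * x with hw
  have hwint : w ∈ 𝒪[F] := by
    rw [Valuation.mem_integer_iff, hw, map_mul, map_inv₀, map_pow]
    calc (valuation F ϖ ^ b)⁻¹ * valuation F x
        ≤ (valuation F ϖ ^ b)⁻¹ * valuation F ϖ ^ b := mul_le_mul_right hv _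
      _ = 1 := inv_mul_cancel₀ hvb
  obtain ⟨r, hr, hwr⟩ := hR w hwint
  refine ⟨r, hr, ?_⟩
  have e : x - ϖ ^ b * r = ϖ ^ b * (w - r) := by
    rw [hw, mul_sub, ← mul_assoc, mul_inv_cancel₀ hpow, one_mul]
  rw [e, map_mul, map_pow]
  calc valuation F ϖ ^ b * valuation F (w - r) ≤ valuation F ϖ ^ b * valuation F ϖ ^ (m - b) :=
        mul_le_mul' le_rfl hwr
    _ = valuation F ϖ ^ m := by rw [← pow_add, Nat.add_sub_cancel' hb]

end Residues

/-! ### Double counting -/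

section Combinatorics

variable {n : ℕ}

/-- `#{t : Fin n | t < m} = min m n`. [folklore] -/
theorem card_filter_val_lt (n m : ℕ) :
    ((univ : Finset (Fin n)).filter fun t : Fin n => (t : ℕ) < m).card = min m n := by
  rw [← Finset.card_range (min m n)]
  refine Finset.card_bij (fun t _ => (t : ℕ)) (fun t ht => ?_) (fun a _ b _ h => Fin.ext h)
    (fun k hk => ?_)
  · simp only [Finset.mem_filter, Finset.mem_univ, true_and] at ht
    simp only [Finset.mem_range, lt_min_iff]
    exact ⟨ht, t.2⟩
  · simp only [Finset.mem_range, lt_min_iff] at hk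
    exact ⟨⟨k, hk.2⟩, by simp [hk.1], rfl⟩

/-- **Double counting, weak form**: `∑_{t<n} ∑_{i ≥ t} a_i = ∑_i (i+1) a_i`. [folklore] -/
theorem sum_sum_Ici_eq (a : Fin n → ℕ) :
    ∑ t : Fin n, ∑ i ∈ Finset.Ici t, a i = ∑ i : Fin n, ((i : ℕ) + 1) * a i := by
  have h : ∀ t : Fin n, ∑ i ∈ Finset.Ici t, a i = ∑ i : Fin n, if t ≤ i then a i else 0 := by
    intro t
    rw [← Finset.sum_filter]
    congr 1
    ext i
    simp
  simp_rw [h]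
  rw [Finset.sum_comm]
  refine Finset.sum_congr rfl fun i _ => ?_
  rw [Finset.sum_ite, Finset.sum_const_zero, add_zero, Finset.sum_const, smul_eq_mul]
  congr 1
  have hf : (univ.filter fun t : Fin n => t ≤ i) =
      univ.filter fun t : Fin n => (t : ℕ) < (i : ℕ) + 1 := by
    ext t
    simp only [Finset.mem_filter, Finset.mem_univ, true_and, Fin.le_def]
    omega
  rw [hf, card_filter_val_lt, min_eq_left (by omega)]

/-- **Double counting, strict form**: `∑_{t<n} ∑_{n ≥ j > t} a_j = ∑_{j ≤ n} j a_j`. [folklore] -/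
theorem sum_sum_ite_lt_eq (a : Fin (n + 1) → ℕ) :
    ∑ t : Fin n, ∑ j : Fin (n + 1), (if (t : ℕ) < (j : ℕ) then a j else 0) =
      ∑ j : Fin (n + 1), (j : ℕ) * a j := by
  rw [Finset.sum_comm]
  refine Finset.sum_congr rfl fun j _ => ?_
  rw [Finset.sum_ite, Finset.sum_const_zero, add_zero, Finset.sum_const, smul_eq_mul,
    card_filter_val_lt, min_eq_left (Nat.lt_succ_iff.1 j.2)]

/-- `tailSum` over `Fin (n+1)` with `n - t` terms is the sum over the indices `> t`. [folklore] -/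
theorem tailSum_sub_eq (a : Fin (n + 1) → ℕ) (t : Fin n) :
    tailSum a (n - t) = ∑ j : Fin (n + 1), if (t : ℕ) < (j : ℕ) then a j else 0 := by
  rw [tailSum]
  refine Finset.sum_congr rfl fun j _ => ?_
  have ht := t.2
  by_cases h : (t : ℕ) < (j : ℕ)
  · rw [if_pos h, if_pos (by omega)]
  · rw [if_neg h, if_neg (by omega)]

/-- Sums along the increasing enumeration of a finset of `Fin n`. [folklore] -/
theorem sum_orderEmbOfFin_eq {k : ℕ} (s : Finset (Fin n)) (h : s.card = k) (a : Fin n → ℕ) :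
    ∑ j : Fin k, a (s.orderEmbOfFin h j) = ∑ i ∈ s, a i := by
  have hs : univ.image (fun j : Fin k => s.orderEmbOfFin h j) = s := by
    rw [← Finset.coe_inj, Finset.coe_image, Finset.coe_univ, Set.image_univ,
      Finset.range_orderEmbOfFin]
  conv_rhs => rw [← hs]
  rw [Finset.sum_image fun x _ y _ hxy => (s.orderEmbOfFin h).injective hxy]

/-- **Union bound for non-negative sums**: if every element of `S` lies in some `T i`, `i ∈ I`,
then `∑_S f ≤ ∑_{i ∈ I} ∑_{T i} f` for `f ≥ 0`. [folklore] -/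
theorem sum_le_sum_sum_of_cover {ι α : Type*} [DecidableEq α] {S : Finset α} {I : Finset ι}
    {T : ι → Finset α} {f : α → ℝ} (hf : ∀ a, 0 ≤ f a) (hcover : ∀ a ∈ S, ∃ i ∈ I, a ∈ T i) :
    ∑ a ∈ S, f a ≤ ∑ i ∈ I, ∑ a ∈ T i, f a := by
  classical
  have hU : ∀ s t : Finset α, ∑ a ∈ s ∪ t, f a ≤ ∑ a ∈ s, f a + ∑ a ∈ t, f a := by
    intro s t
    have h := Finset.sum_union_inter (s₁ := s) (s₂ := t) (f := f)
    have h0 : 0 ≤ ∑ a ∈ s ∩ t, f a := Finset.sum_nonneg fun a _ => hf a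
    linarith
  have hbi : ∀ J : Finset ι, ∑ a ∈ J.biUnion T, f a ≤ ∑ i ∈ J, ∑ a ∈ T i, f a := by
    intro J
    induction J using Finset.induction_on with
    | empty => simp
    | insert i J hi ih =>
      rw [Finset.biUnion_insert, Finset.sum_insert hi]
      exact (hU _ _).trans (by linarith)
  calc ∑ a ∈ S, f a ≤ ∑ a ∈ I.biUnion T, f a :=
        Finset.sum_le_sum_of_subset_of_nonneg (fun a ha => Finset.mem_biUnion.2 (hcover a ha))
          fun a _ _ => hf a
    _ ≤ _ := hbi I

/-- The antitone `a ∈ ℕⁿ` with `∑ a_i ≤ m` (the shapes of the double cosets `K ϖ^a K ⊆ GL_n` of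
determinant valuation `≤ m`). [folklore] -/
def antitoneLe (n m : ℕ) : Finset (Fin n → ℕ) :=
  (Fintype.piFinset fun _ : Fin n => Finset.range (m + 1)).filter fun a => Antitone a ∧ ∑ i, a i ≤ m

/-- Membership in `antitoneLe`. [folklore] -/
theorem mem_antitoneLe {m : ℕ} {a : Fin n → ℕ} :
    a ∈ antitoneLe n m ↔ Antitone a ∧ ∑ i, a i ≤ m := by
  simp only [antitoneLe, Finset.mem_filter, Fintype.mem_piFinset, Finset.mem_range,
    and_iff_right_iff_imp]
  rintro ⟨-, hsum⟩ i
  exact Nat.lt_succ_of_le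
    ((Finset.single_le_sum (fun j _ => Nat.zero_le (a j)) (Finset.mem_univ i)).trans hsum)

/-- `#antitoneLe n m ≤ (m+1)ⁿ`. [folklore] -/
theorem card_antitoneLe_le (n m : ℕ) : (antitoneLe n m).card ≤ (m + 1) ^ n := by
  refine (Finset.card_filter_le _ _).trans ?_
  rw [Fintype.card_piFinset, Finset.prod_const, Finset.card_range, Finset.card_univ,
    Fintype.card_fin]

/-- **The exponents of the recursion telescope exactly**:
`2 (∑ (i+1) λ'_i - ∑ j λ_j) + (n|λ| - (n+1)|λ'|) + 2⟨ρ_n, λ'⟩ = 2⟨ρ_{n+1}, λ⟩`. [folklore] -/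
theorem twoRho_recursion_identity (lam : Fin (n + 1) → ℕ) (lam' : Fin n → ℕ) :
    2 * ((∑ i : Fin n, (((i : ℕ) : ℤ) + 1) * lam' i) - ∑ j : Fin (n + 1), ((j : ℕ) : ℤ) * lam j) +
      ((n : ℤ) * (∑ j, lam j : ℕ) - ((n : ℤ) + 1) * (∑ i, lam' i : ℕ)) +
      twoRho (fun i => (lam' i : ℤ)) = twoRho (fun j => (lam j : ℤ)) := by
  have h1 : 2 * (∑ i : Fin n, (((i : ℕ) : ℤ) + 1) * lam' i) - ((n : ℤ) + 1) * (∑ i, lam' i : ℕ) +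
      twoRho (fun i => (lam' i : ℤ)) = 0 := by
    rw [twoRho]
    push_cast
    rw [Finset.mul_sum, Finset.mul_sum, ← Finset.sum_sub_distrib, ← Finset.sum_add_distrib]
    exact Finset.sum_eq_zero fun i _ => by ring
  have h2 : -(2 * ∑ j : Fin (n + 1), ((j : ℕ) : ℤ) * lam j) + (n : ℤ) * (∑ j, lam j : ℕ) =
      twoRho (fun j => (lam j : ℤ)) := by
    rw [twoRho]
    push_cast
    rw [Finset.mul_sum, Finset.mul_sum, ← Finset.sum_neg_distrib, ← Finset.sum_add_distrib]
    exact Finset.sum_congr rfl fun j _ => by ring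
  linear_combination h1 + h2

end Combinatorics

/-! ### The fibre count -/

section Counting

variable {F : Type*} [Field F] [ValuativeRel F] {n : ℕ} [IsDiscreteValuationRing 𝒪[F]] {ϖ : F}
  (hϖ : IsUniformizingElement ϖ) [Finite 𝓀[F]]

/-- **The fibre count.** For `λ ∈ ℕ^{n+1}` antitone and `λ' ∈ ℕⁿ`,
`#{[[ϖ^{λ'}, x], [0, ϖ^e]] K ⊆ K ϖ^λ K : x ∈ 𝒪ⁿ} ≤ q^{∑_i (i+1) λ'_i - ∑_j j λ_j}`.
Proof: `e = |λ| - |λ'|` (determinants); modulo `ϖ^{λ'} 𝒪ⁿ` the column `x` does not change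
the coset; the bordered minors of `[[ϖ^{λ'}, x], [0, ϖ^e]] ∈ K ϖ^λ K`
(`SatakeParametersGLXiMinors`) force `|x_t| ≤ |ϖ|^{b_t}`, `b_t = ∑_{j>t} λ_j ∸ ∑_{i>t} λ'_i`,
and the diagonal minors force `∑_{j>t} λ_j ≤ ∑_{i≥t} λ'_i`; so `x_t` is determined modulo
`ϖ^{λ'_t}` by an element of a residue system modulo `ϖ^{λ'_t - min(b_t, λ'_t)}`, and
`∑_t (λ'_t - min(b_t, λ'_t)) ≤ ∑_t (∑_{i ≥ t} λ'_i - ∑_{j > t} λ_j) = ∑ (i+1) λ'_i - ∑ j λ_j`.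
[folklore] -/
theorem ncard_xiFib_piPowGL_le {lam : Fin (n + 1) → ℕ} (hlam : Antitone lam) (lam' : Fin n → ℕ) :
    ((xiFib hϖ lam (piPowGL hϖ.ne_zero lam')).ncard : ℝ) ≤
      (Nat.card 𝓀[F] : ℝ) ^ ((∑ i : Fin n, (((i : ℕ) : ℤ) + 1) * lam' i) -
        ∑ j : Fin (n + 1), ((j : ℕ) : ℤ) * lam j) := by
  classical
  have hq1 : (1 : ℝ) ≤ (Nat.card 𝓀[F] : ℝ) := by
    haveI := Fintype.ofFinite 𝓀[F]
    exact_mod_cast Nat.one_le_iff_ne_zero.2 Nat.card_pos.ne'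
  have hv0 : 0 < valuation F ϖ := (Valuation.pos_iff _).2 hϖ.ne_zero
  have hv1 : valuation F ϖ < 1 := hϖ.valuation_lt_one
  rcases (xiFib hϖ lam (piPowGL hϖ.ne_zero lam')).eq_empty_or_nonempty with h0 | ⟨c₀, hc₀⟩
  · rw [h0, Set.ncard_empty, Nat.cast_zero]
    exact zpow_nonneg (zero_le_one.trans hq1) _
  -- notation for the tail sums
  set Sgt : Fin n → ℕ := fun t => ∑ j : Fin (n + 1), if (t : ℕ) < (j : ℕ) then lam j else 0
    with hSgt
  -- the minors of a bordered matrix in `K ϖ^λ K`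
  have hminor : ∀ {x : Fin n → F} {e : ℕ},
      ((cornerExtGL (piPowGL hϖ.ne_zero lam') x (ϖ ^ e) (pow_ne_zero e hϖ.ne_zero) :
          GL (Fin (n + 1)) F) : GL (Fin (n + 1)) F ⧸ glInt (n + 1) F) ∈
        orbit (glInt (n + 1) F) ((piPowGL hϖ.ne_zero lam : GL (Fin (n + 1)) F) :
          GL (Fin (n + 1)) F ⧸ glInt (n + 1) F) →
      ∀ t : Fin n, Sgt t ≤ ∑ i ∈ Finset.Ici t, lam' i ∧
        valuation F (x t) * valuation F ϖ ^ (∑ i ∈ Finset.Ioi t, lam' i) ≤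
          valuation F ϖ ^ Sgt t := by
    intro x e hco t
    obtain ⟨a, ha, b, hb, hab⟩ := (heckeAlgebra.coe_mem_orbit_coe_iff _ _ _).1 hco
    have hX : ((cornerExtGL (piPowGL hϖ.ne_zero lam') x (ϖ ^ e) (pow_ne_zero e hϖ.ne_zero) :
        GL (Fin (n + 1)) F) : Matrix (Fin (n + 1)) (Fin (n + 1)) F) =
        cornerExt (Matrix.diagonal fun i => ϖ ^ lam' i) x (ϖ ^ e) := by
      rw [coe_cornerExtGL, coe_piPowGL]; rfl
    constructor
    · -- the diagonal tail minor on `Ici t`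
      set g := (Finset.Ici t).orderEmbOfFin (Fin.card_Ici t) with hg
      have h := valuation_det_submatrix_le_of_eq_mul_piPowGL_mul hϖ.ne_zero hϖ.valuation_le_one
        hlam ha hb hab (Fin.castSucc ∘ g) (Fin.castSucc ∘ g) (injective_castSucc_comp g.injective)
      rw [hX, submatrix_cornerExt_diagonal_tail _ _ _ g.injective, Matrix.det_diagonal, map_prod,
        tailSum_sub_eq] at h
      simp only [Function.comp_apply, map_pow, Finset.prod_pow_eq_pow_sum] at h
      rw [sum_orderEmbOfFin_eq] at h
      exact (pow_le_pow_iff_right_of_lt_one₀ hv0 hv1).1 h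
    · -- the bordered minor on `Ioi t`
      set g := (Finset.Ioi t).orderEmbOfFin (Fin.card_Ioi t) with hg
      have hgt : ∀ j, g j ≠ t := fun j h => by
        have hm : g j ∈ Finset.Ioi t := Finset.orderEmbOfFin_mem _ _ j
        rw [h, Finset.mem_Ioi] at hm
        exact lt_irrefl _ hm
      have h := valuation_det_submatrix_le_of_eq_mul_piPowGL_mul hϖ.ne_zero hϖ.valuation_le_one
        hlam ha hb hab (borderRows t g) (borderCols g) (borderCols_injective g.injective)
      rw [hX, det_submatrix_cornerExt_diagonal_border _ _ _ t g.injective hgt, map_mul, map_prod]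
        at h
      simp only [map_pow, Finset.prod_pow_eq_pow_sum] at h
      rw [sum_orderEmbOfFin_eq] at h
      have hk : n - 1 - (t : ℕ) + 1 = n - t := by have := t.2; omega
      rw [hk, tailSum_sub_eq] at h
      exact h
  -- the constraints `(ii)` from the witness `c₀`
  have hii : ∀ t : Fin n, Sgt t ≤ ∑ i ∈ Finset.Ici t, lam' i := by
    obtain ⟨hco, x, e, -, rfl⟩ := hc₀
    exact fun t => (hminor hco t).1
  -- digits
  have hresidues : ∀ N : ℕ, ∃ R : Finset F, (∀ r ∈ R, r ∈ 𝒪[F]) ∧ R.card ≤ Nat.card 𝓀[F] ^ N ∧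
      ∀ x ∈ 𝒪[F], ∃ r ∈ R, valuation F (x - r) ≤ valuation F ϖ ^ N := fun N =>
    exists_finset_residues_pow_card_le hϖ N
  choose R hRint hRcard hRcomplete using hresidues
  set b : Fin n → ℕ := fun t => Sgt t - ∑ i ∈ Finset.Ioi t, lam' i with hbdef
  set b' : Fin n → ℕ := fun t => min (b t) (lam' t) with hb'def
  set e₀ : ℕ := ∑ j, lam j - ∑ i, lam' i with he₀
  set Box : Finset (Fin n → F) := Fintype.piFinset fun t => R (lam' t - b' t) with hBox
  set Φ : (Fin n → F) → GL (Fin (n + 1)) F ⧸ glInt (n + 1) F := fun r =>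
    ((cornerExtGL (piPowGL hϖ.ne_zero lam') (fun t => ϖ ^ b' t * r t) (ϖ ^ e₀)
      (pow_ne_zero e₀ hϖ.ne_zero) : GL (Fin (n + 1)) F) : GL (Fin (n + 1)) F ⧸ glInt (n + 1) F)
    with hΦ
  -- the fibre lies in the image of the box
  have hsub : xiFib hϖ lam (piPowGL hϖ.ne_zero lam') ⊆ Φ '' (Box : Set (Fin n → F)) := by
    rintro c ⟨hco, x, e, hx, rfl⟩
    have he : e + ∑ i, lam' i = ∑ j, lam j :=
      add_eq_sum_of_coe_cornerExtGL_mem_orbit hϖ (piPowGL_mem_glIntDet hϖ lam') hco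
    have hee : e = e₀ := by rw [he₀]; omega
    -- valuations of the entries of `x`
    have hval : ∀ t, valuation F (x t) ≤ valuation F ϖ ^ b' t := by
      intro t
      have h2 := (hminor hco t).2
      have hxt : valuation F (x t) ≤ valuation F ϖ ^ b t := by
        by_cases hle : ∑ i ∈ Finset.Ioi t, lam' i ≤ Sgt t
        · have hsplit : valuation F ϖ ^ Sgt t =
              valuation F ϖ ^ b t * valuation F ϖ ^ (∑ i ∈ Finset.Ioi t, lam' i) := by
            rw [← pow_add, hbdef]
            congr 1
            dsimp only
            omega
          rw [hsplit] at h2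
          exact le_of_mul_le_mul_right h2 (pow_pos hv0 _)
        · have hb0 : b t = 0 := by rw [hbdef]; dsimp only; omega
          rw [hb0, pow_zero]
          exact (Valuation.mem_integer_iff _ _).1 (hx t)
      exact hxt.trans (pow_le_pow_right_of_le_one' hv1.le (min_le_left _ _))
    have hdig : ∀ t, ∃ r ∈ R (lam' t - b' t),
        valuation F (x t - ϖ ^ b' t * r) ≤ valuation F ϖ ^ lam' t := fun t =>
      exists_sub_pow_mul_le hϖ (min_le_right _ _) (hval t) (hRcomplete _)
    choose r hrR hr using hdig
    refine ⟨r, Finset.mem_coe.2 (Fintype.mem_piFinset.2 hrR), ?_⟩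
    rw [hΦ, hee]
    dsimp only
    symm
    -- `x = ϖ^{λ'} z + x̄` with `z` integral
    refine coe_cornerExtGL_eq_of_eq_mulVec_add _
      (z := fun t => (ϖ ^ lam' t)⁻¹ * (x t - ϖ ^ b' t * r t)) (fun t => ?_) ?_ _
    · rw [Valuation.mem_integer_iff, map_mul, map_inv₀, map_pow]
      have hvl : valuation F ϖ ^ lam' t ≠ 0 := pow_ne_zero _ hv0.ne'
      calc (valuation F ϖ ^ lam' t)⁻¹ * valuation F (x t - ϖ ^ b' t * r t)
          ≤ (valuation F ϖ ^ lam' t)⁻¹ * valuation F ϖ ^ lam' t := mul_le_mul_right (hr t) _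
        _ = 1 := inv_mul_cancel₀ hvl
    · funext t
      rw [Pi.add_apply, coe_piPowGL]
      change x t = (Matrix.diagonal (fun i => ϖ ^ lam' i) *ᵥ _) t + _
      rw [Matrix.mulVec_diagonal, ← mul_assoc, mul_inv_cancel₀ (pow_ne_zero _ hϖ.ne_zero), one_mul,
        sub_add_cancel]
  -- cardinalities
  have h1 : (xiFib hϖ lam (piPowGL hϖ.ne_zero lam')).ncard ≤ Box.card :=
    (Set.ncard_le_ncard hsub ((Finset.finite_toSet Box).image Φ)).trans
      ((Set.ncard_image_le (Finset.finite_toSet Box)).trans (Set.ncard_coe_finset Box).le)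
  have h2 : Box.card ≤ Nat.card 𝓀[F] ^ ∑ t, (lam' t - b' t) := by
    rw [hBox, Fintype.card_piFinset, ← Finset.prod_pow_eq_pow_sum]
    exact Finset.prod_le_prod' fun t _ => hRcard _
  -- the exponent
  have h3 : ((∑ t, (lam' t - b' t) : ℕ) : ℤ) ≤
      (∑ i : Fin n, (((i : ℕ) : ℤ) + 1) * lam' i) - ∑ j : Fin (n + 1), ((j : ℕ) : ℤ) * lam j := by
    have hper : ∀ t : Fin n, ((lam' t - b' t : ℕ) : ℤ) ≤
        ((∑ i ∈ Finset.Ici t, lam' i : ℕ) : ℤ) - ((Sgt t : ℕ) : ℤ) := by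
      intro t
      have hIci : ∑ i ∈ Finset.Ici t, lam' i = lam' t + ∑ i ∈ Finset.Ioi t, lam' i := by
        rw [Finset.Ici_eq_cons_Ioi, Finset.sum_cons]
      have hiit := hii t
      rw [hIci] at hiit ⊢
      simp only [hb'def, hbdef]
      set A := ∑ i ∈ Finset.Ioi t, lam' i with hA
      set B := Sgt t with hB
      set L := lam' t with hL
      rcases le_total (B - A) L with hle | hle
      · rw [min_eq_left hle]
        omega
      · rw [min_eq_right hle]
        omega
    calc ((∑ t, (lam' t - b' t) : ℕ) : ℤ) = ∑ t, ((lam' t - b' t : ℕ) : ℤ) := by push_cast; rfl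
      _ ≤ ∑ t : Fin n, (((∑ i ∈ Finset.Ici t, lam' i : ℕ) : ℤ) - ((Sgt t : ℕ) : ℤ)) :=
          Finset.sum_le_sum fun t _ => hper t
      _ = ((∑ t : Fin n, ∑ i ∈ Finset.Ici t, lam' i : ℕ) : ℤ) - ((∑ t : Fin n, Sgt t : ℕ) : ℤ) := by
          push_cast
          rw [Finset.sum_sub_distrib]
      _ = _ := by
          rw [sum_sum_Ici_eq, hSgt, sum_sum_ite_lt_eq]
          push_cast
          ring
  calc ((xiFib hϖ lam (piPowGL hϖ.ne_zero lam')).ncard : ℝ)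
      ≤ ((Nat.card 𝓀[F] ^ ∑ t, (lam' t - b' t) : ℕ) : ℝ) := by exact_mod_cast h1.trans h2
    _ = (Nat.card 𝓀[F] : ℝ) ^ (((∑ t, (lam' t - b' t) : ℕ)) : ℤ) := by
        rw [zpow_natCast]; push_cast; rfl
    _ ≤ _ := zpow_le_zpow_right₀ hq1 h3

end Counting

/-! ### The recursion and the Harish-Chandra estimate -/

section SqrtCard

variable (F : Type*) [Field F] [ValuativeRel F]

/-- `Q = √q`, `q = #𝓀` the residue cardinality. [folklore] -/
def sqrtResidueCard : ℝ := Real.sqrt (Nat.card 𝓀[F] : ℝ)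

variable {F}

/-- `Q² = q`. [folklore] -/
theorem sqrtResidueCard_sq : sqrtResidueCard F ^ 2 = (Nat.card 𝓀[F] : ℝ) :=
  Real.sq_sqrt (Nat.cast_nonneg _)

/-- `1 < Q` for a finite residue field. [folklore] -/
theorem one_lt_sqrtResidueCard [Finite 𝓀[F]] : 1 < sqrtResidueCard F := by
  rw [sqrtResidueCard, Real.lt_sqrt zero_le_one, one_pow]
  exact_mod_cast Finite.one_lt_card

/-- `0 < Q` for a finite residue field. [folklore] -/
theorem sqrtResidueCard_pos [Finite 𝓀[F]] : 0 < sqrtResidueCard F :=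
  one_pos.trans one_lt_sqrtResidueCard

/-- `q^B = Q^{2B}`. [folklore] -/
theorem card_zpow_eq_sqrtResidueCard_zpow [Finite 𝓀[F]] (B : ℤ) :
    (Nat.card 𝓀[F] : ℝ) ^ B = sqrtResidueCard F ^ (2 * B) := by
  rw [_root_.zpow_mul, ← sqrtResidueCard_sq]
  norm_cast

end SqrtCard

section Recursion

variable {F : Type*} [Field F] [ValuativeRel F] {n : ℕ} [IsDiscreteValuationRing 𝒪[F]] {ϖ : F}
  (hϖ : IsUniformizingElement ϖ) [Finite 𝓀[F]]

/-- **The recursion.** For `λ ∈ ℕ^{n+1}` antitone,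
`Ξ-sum_{n+1}(ϖ^λ) ≤ ∑_{λ' antitone, |λ'| ≤ |λ|} Q^{2B(λ,λ') + n|λ| - (n+1)|λ'|} · Ξ-sum_n(ϖ^{λ'})`
with `B(λ, λ') = ∑ (i+1) λ'_i - ∑ j λ_j`: cover `K ϖ^λ K / K` by the fibres of the bordered cosets
(`exists_mem_xiFib_out`), count each fibre (`ncard_xiFib_piPowGL_le`) and factor the weights
(`xiWeight_of_mem_xiFib`). [folklore] -/
theorem xiSum_piPowGL_succ_le {lam : Fin (n + 1) → ℕ} (hlam : Antitone lam) :
    xiSum hϖ (sqrtResidueCard F) (piPowGL hϖ.ne_zero lam) ≤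
      ∑ lam' ∈ antitoneLe n (∑ j, lam j),
        sqrtResidueCard F ^ (2 * ((∑ i : Fin n, (((i : ℕ) : ℤ) + 1) * lam' i) -
            ∑ j : Fin (n + 1), ((j : ℕ) : ℤ) * lam j) +
          ((n : ℤ) * (∑ j, lam j : ℕ) - ((n : ℤ) + 1) * (∑ i, lam' i : ℕ))) *
        xiSum hϖ (sqrtResidueCard F) (piPowGL hϖ.ne_zero lam') := by
  classical
  set Q := sqrtResidueCard F with hQdef
  have hQ : 0 < Q := sqrtResidueCard_pos
  rw [xiSum_eq_sum hϖ Q (finite_orbit_piPowGL hϖ lam)]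
  -- the cover of `K ϖ^λ K / K` by the fibres
  set T : (Fin n → ℕ) → Finset (GL (Fin (n + 1)) F ⧸ glInt (n + 1) F) := fun lam' =>
    (finite_orbit_piPowGL hϖ lam').toFinset.biUnion fun c' => (finite_xiFib hϖ lam c'.out).toFinset
    with hT
  have hcover : ∀ c ∈ (finite_orbit_piPowGL hϖ lam).toFinset, ∃ lam' ∈ antitoneLe n (∑ j, lam j),
      c ∈ T lam' := by
    intro c hc
    rw [Set.Finite.mem_toFinset] at hc
    obtain ⟨lam', hanti, hsum, c', hc', hmem⟩ := exists_mem_xiFib_out hϖ lam hc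
    exact ⟨lam', mem_antitoneLe.2 ⟨hanti, hsum⟩, Finset.mem_biUnion.2
      ⟨c', (Set.Finite.mem_toFinset _).2 hc', (Set.Finite.mem_toFinset _).2 hmem⟩⟩
  refine (sum_le_sum_sum_of_cover (fun c => xiWeight_nonneg hQ.le _) hcover).trans
    (Finset.sum_le_sum fun lam' hlam' => ?_)
  -- a fixed `λ'`
  set B : ℤ := (∑ i : Fin n, (((i : ℕ) : ℤ) + 1) * lam' i) - ∑ j : Fin (n + 1), ((j : ℕ) : ℤ) * lam j
    with hB
  set sh : ℤ := (n : ℤ) * (∑ j, lam j : ℕ) - ((n : ℤ) + 1) * (∑ i, lam' i : ℕ) with hsh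
  have hcover' : ∀ c ∈ T lam', ∃ c' ∈ (finite_orbit_piPowGL hϖ lam').toFinset,
      c ∈ (finite_xiFib hϖ lam c'.out).toFinset := fun c hc => Finset.mem_biUnion.1 hc
  refine (sum_le_sum_sum_of_cover (fun c => xiWeight_nonneg hQ.le _) hcover').trans ?_
  -- on each fibre the weight is constant and the fibre is counted
  have hfib : ∀ c' ∈ (finite_orbit_piPowGL hϖ lam').toFinset,
      ∑ c ∈ (finite_xiFib hϖ lam c'.out).toFinset, xiWeight Q (iwasawaExp hϖ c.out) ≤
        Q ^ (2 * B) * Q ^ sh * xiWeight Q (iwasawaExp hϖ c'.out) := by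
    intro c' hc'
    rw [Set.Finite.mem_toFinset] at hc'
    have hc'' : ((c'.out : GL (Fin n) F) : GL (Fin n) F ⧸ glInt n F) ∈ orbit (glInt n F)
        ((piPowGL hϖ.ne_zero lam' : GL (Fin n) F) : GL (Fin n) F ⧸ glInt n F) := by
      rwa [QuotientGroup.out_eq']
    have hconst : ∀ c ∈ (finite_xiFib hϖ lam c'.out).toFinset, xiWeight Q (iwasawaExp hϖ c.out) =
        xiWeight Q (iwasawaExp hϖ c'.out) * Q ^ sh := by
      intro c hc
      rw [Set.Finite.mem_toFinset] at hc
      exact xiWeight_of_mem_xiFib hϖ hQ hc'' hc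
    rw [Finset.sum_congr rfl hconst, Finset.sum_const, nsmul_eq_mul]
    -- the fibre count
    obtain ⟨a, ha, b, hb, hab⟩ := (heckeAlgebra.coe_mem_orbit_coe_iff _ _ _).1 hc''
    have hcard : (((finite_xiFib hϖ lam c'.out).toFinset.card : ℕ) : ℝ) ≤ Q ^ (2 * B) := by
      rw [← Set.ncard_eq_toFinset_card _ (finite_xiFib hϖ lam c'.out), hab,
        xiFib_mul_glInt hϖ lam _ hb, ncard_xiFib_glInt_mul hϖ lam _ ha, hQdef,
        ← card_zpow_eq_sqrtResidueCard_zpow]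
      exact ncard_xiFib_piPowGL_le hϖ hlam lam'
    have hw : 0 ≤ xiWeight Q (iwasawaExp hϖ c'.out) * Q ^ sh :=
      mul_nonneg (xiWeight_nonneg hQ.le _) (zpow_nonneg hQ.le _)
    calc (((finite_xiFib hϖ lam c'.out).toFinset.card : ℕ) : ℝ) *
          (xiWeight Q (iwasawaExp hϖ c'.out) * Q ^ sh)
        ≤ Q ^ (2 * B) * (xiWeight Q (iwasawaExp hϖ c'.out) * Q ^ sh) :=
          mul_le_mul_of_nonneg_right hcard hw
      _ = Q ^ (2 * B) * Q ^ sh * xiWeight Q (iwasawaExp hϖ c'.out) := by ring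
  refine (Finset.sum_le_sum hfib).trans (le_of_eq ?_)
  rw [← Finset.mul_sum, ← xiSum_eq_sum hϖ Q (finite_orbit_piPowGL hϖ lam'), zpow_add₀ hQ.ne']

omit [IsDiscreteValuationRing 𝒪[F]] [Finite 𝓀[F]] in
/-- `ϖ^a = 1` in the trivial group `GL_0(F)`. [folklore] -/
theorem piPowGL_fin_zero (a : Fin 0 → ℕ) : piPowGL hϖ.ne_zero a = 1 :=
  Units.ext (Matrix.ext fun i _ => Fin.elim0 i)

/-- **The Harish-Chandra estimate for `GL_n`** (upper half of Harish-Chandra's inequalities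
`δ^{1/2} ≤ Ξ ≤ C δ^{1/2} (1 + σ)^d` for the spherical function `Ξ` of `GL_n(F)`; Macdonald (1971),
Cartier (1979) §IV, Waldspurger (2003) Lemme II.1.1): for `λ ∈ ℕⁿ` antitone,
`∑_{c ∈ K ϖ^λ K / K} Q^{-2⟨ρ, e(c)⟩} ≤ (|λ| + 1)^{n²} Q^{2⟨ρ, λ⟩}`, i.e.
`Ξ(ϖ^λ) · #(K ϖ^λ K / K) ≤ (|λ|+1)^{n²} q^{⟨ρ, λ⟩}`. Proof: induction on `n` through the
recursion `xiSum_piPowGL_succ_le`, whose exponents telescope exactly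
(`twoRho_recursion_identity`), with at most `(|λ|+1)ⁿ` shapes `λ'` at each step.
[cite: CartierCorvallis1979, §IV.2] -/
theorem xiSum_piPowGL_le : ∀ (d : ℕ) (lam : Fin d → ℕ), Antitone lam →
    xiSum hϖ (sqrtResidueCard F) (piPowGL hϖ.ne_zero lam) ≤
      ((∑ i, lam i : ℕ) + 1 : ℝ) ^ (d * d) * sqrtResidueCard F ^ twoRho (fun i => (lam i : ℤ)) := by
  set Q := sqrtResidueCard F with hQdef
  have hQ : 0 < Q := sqrtResidueCard_pos
  intro d
  induction d with
  | zero =>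
    intro lam _
    rw [piPowGL_fin_zero hϖ, xiSum_one]
    simp [twoRho]
  | succ d ih =>
    intro lam hlam
    set m : ℕ := ∑ j, lam j with hm
    have hm1 : (1 : ℝ) ≤ (m : ℝ) + 1 := by simp
    refine (xiSum_piPowGL_succ_le hϖ hlam).trans ?_
    -- bound each term through the induction hypothesis and the exponent identity
    have hterm : ∀ lam' ∈ antitoneLe d m,
        Q ^ (2 * ((∑ i : Fin d, (((i : ℕ) : ℤ) + 1) * lam' i) -
              ∑ j : Fin (d + 1), ((j : ℕ) : ℤ) * lam j) +
            ((d : ℤ) * (m : ℕ) - ((d : ℤ) + 1) * (∑ i, lam' i : ℕ))) *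
          xiSum hϖ Q (piPowGL hϖ.ne_zero lam') ≤
        ((m : ℝ) + 1) ^ (d * d) * Q ^ twoRho (fun j => (lam j : ℤ)) := by
      intro lam' hlam'
      obtain ⟨hanti, hsum⟩ := mem_antitoneLe.1 hlam'
      have hih := ih lam' hanti
      have hE : Q ^ (2 * ((∑ i : Fin d, (((i : ℕ) : ℤ) + 1) * lam' i) -
              ∑ j : Fin (d + 1), ((j : ℕ) : ℤ) * lam j) +
            ((d : ℤ) * (m : ℕ) - ((d : ℤ) + 1) * (∑ i, lam' i : ℕ))) *
          Q ^ twoRho (fun i => (lam' i : ℤ)) = Q ^ twoRho (fun j => (lam j : ℤ)) := by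
        rw [← zpow_add₀ hQ.ne', hm, twoRho_recursion_identity]
      have hpoly : ((∑ i, lam' i : ℕ) + 1 : ℝ) ^ (d * d) ≤ ((m : ℝ) + 1) ^ (d * d) :=
        pow_le_pow_left₀ (by positivity) (by exact_mod_cast Nat.add_le_add_right hsum 1) _
      calc _ ≤ Q ^ (2 * ((∑ i : Fin d, (((i : ℕ) : ℤ) + 1) * lam' i) -
              ∑ j : Fin (d + 1), ((j : ℕ) : ℤ) * lam j) +
            ((d : ℤ) * (m : ℕ) - ((d : ℤ) + 1) * (∑ i, lam' i : ℕ))) *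
            (((∑ i, lam' i : ℕ) + 1 : ℝ) ^ (d * d) * Q ^ twoRho (fun i => (lam' i : ℤ))) :=
            mul_le_mul_of_nonneg_left hih (zpow_nonneg hQ.le _)
        _ = ((∑ i, lam' i : ℕ) + 1 : ℝ) ^ (d * d) * Q ^ twoRho (fun j => (lam j : ℤ)) := by
            rw [← hE]; ring
        _ ≤ _ := mul_le_mul_of_nonneg_right hpoly (zpow_nonneg hQ.le _)
    refine (Finset.sum_le_sum hterm).trans ?_
    rw [Finset.sum_const, nsmul_eq_mul]
    have hcard : (((antitoneLe d m).card : ℕ) : ℝ) ≤ ((m : ℝ) + 1) ^ d := by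
      exact_mod_cast card_antitoneLe_le d m
    calc (((antitoneLe d m).card : ℕ) : ℝ) * (((m : ℝ) + 1) ^ (d * d) * Q ^ twoRho (fun j => (lam j : ℤ)))
        ≤ ((m : ℝ) + 1) ^ d * (((m : ℝ) + 1) ^ (d * d) * Q ^ twoRho (fun j => (lam j : ℤ))) :=
          mul_le_mul_of_nonneg_right hcard (by positivity)
      _ = ((m : ℝ) + 1) ^ (d + d * d) * Q ^ twoRho (fun j => (lam j : ℤ)) := by rw [pow_add]; ring
      _ ≤ ((m : ℝ) + 1) ^ ((d + 1) * (d + 1)) * Q ^ twoRho (fun j => (lam j : ℤ)) :=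
          mul_le_mul_of_nonneg_right (pow_le_pow_right₀ hm1 (by nlinarith)) (zpow_nonneg hQ.le _)

end Recursion

end Literature.NumberTheory.Automorphic
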